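import Literature.NumberTheory.LFunctions.RodgersTaoHamiltonianTermFTCProofs
import Literature.NumberTheory.LFunctions.RodgersTaoSeriesAbsContinuityProofs
import Literature.NumberTheory.LFunctions.RodgersTaoWeakEnergyAssemblyProofs
import Literature.NumberTheory.LFunctions.RodgersTaoTruncHamiltonianExpansionProofs
import Literature.NumberTheory.LFunctions.RodgersTaoTruncEnergyIntegrableProofs
import HarnessLib

/-!
# Rodgers–Tao 2020, Proposition 22 — STAGE A: `H̃_T` is absolutely continuous and (78) holds almost everywhere

RH-FREE CONTENT (0 definitions / 0 named facts / no `sorry`). Trunk T-ANT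
(`Literature/NumberTheory/LFunctions`); companion of `RodgersTaoHamiltonian.lean` (the typed,
VACUOUS-AS-PRINTED / EX-FALSO fact
`Literature.NumberTheory.LFunctions.rodgers_tao_truncHamiltonian_deriv` = Prop. 22, FMP p. 48 (76),
whose ex-falso discharge `rodgers_tao_truncHamiltonian_deriv_holds` lives in
`RodgersTaoHamiltonianProofs.lean`). C3 cell CONTENT-TWIN programme, row «P22 STAGE A» of the
staging map in `RodgersTaoSeriesAbsContinuityProofs.lean` (ROW 5: the ABSTRACT dominated-convergence
/ Lebesgue-differentiation step) and `RodgersTaoHamiltonianTermFTCProofs.lean` (ROW 6: the termwise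
fundamental theorem of calculus for (77)); this module supplies the remaining `L¹` hypothesis
(«hsum»), assembles the first sentence of Prop. 22 with the a.e. derivative as the
(77)-series, and desymmetrises it into (78) almost everywhere.

> B. Rodgers, T. Tao, *The de Bruijn–Newman constant is non-negative*, Forum Math. Pi 8 (2020) e6,
> **Proposition 22** (FMP p. 48; = arXiv:1801.05914v4 Prop. 7.7, v5 TeX l. 1210–1259, label
> `dorium`): «In the range `Λ/2 ≤ t ≤ 0`, the function `H̃_T` is absolutely continuous, and the
> derivative `∂ₜH̃_T(t)` is equal to `−4Ẽ_T(t)` plus negligible terms for almost all `t`.» Proof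
> (pp. 48–50): (77) `∂ₜH_{jk} = −(2/(x_k − x_j))(Σ'_{i≠k} 1/(x_k−x_i) − Σ'_{i≠j} 1/(x_j−x_i))`; (78)
> the formal identity; «However, we need to justify the interchange of the derivative and the
> infinite summation. First, we use the fundamental theorem of calculus to rewrite (77) in integral
> form […] Multiplying by `ψ_T(j)ψ_T(k)` […] By the dominated convergence theorem, we can interchange
> the outer sum and the integral as soon as we can show that the expression
> `Σ_{j∼_T k} ψ_T(j)ψ_T(k) ∫_{t₀}^0 (1/|x_k−x_j|)(|Σ'_{i≠k} 1/(x_k−x_i)| + |Σ'_{i≠j} 1/(x_j−x_i)|) dt` is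
> finite. By symmetry […] it suffices to show that (79) is finite. But using (50) and (52), we can
> crudely bound `|Σ'_{i≠k} 1/(x_k−x_i)|, 1/|x_k−x_j| ≪ log₊^{O(1)}(k)(1/|x_k−x_{k−1}| + 1/|x_k−x_{k+1}|)`
> (using the convention `x_0(t) = 0`), so expression (79) may in turn be crudely bounded by
> `Σ_k ψ_T²(k)(T+|k|)^{0.1} log₊^{O(1)}(k) ∫_{t₀}^0 (1/|x_k−x_{k−1}|² + 1/|x_k−x_{k+1}|²) dt`, and this
> will be finite thanks to Proposition 15 and (66). […] The above analysis also shows that the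
> integrand is absolutely integrable in time. From the Lebesgue differentiation theorem, we conclude
> that `H̃_T` is absolutely continuous and that (78) holds at almost every time `t`.»

## Main results (all `theorem`s)

* `RodgersTaoTruncHamiltonianAC.abs_zeroVelocitySum_le` — the «crude bound» for the principal value
  velocity `Σ'_{i≠k} 1/(x_k − x_i)` of (56): `≤ 1/(2|x_k|) + (3|x_k| + 8x_k²/μ) Σ_{m≥1} 1/x_m²` for any
  `μ > 0` separating `x_k` from the other `x_i` (e.g. the adjacent gap), from the closed form of the
  principal value sum (`zeroVelocityPartialSum_eq_sum`, Thm. 11) and the two regimes `x_m ≥ 2|x_k|`,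
  `x_m < 2|x_k|` (`abs_velocity_term_le`);
* `RodgersTaoTruncHamiltonianAC.abs_zeroVelocitySum_div_gap_le`, `abs_oda_le`,
  `abs_weighted_oda_le` — the per-index and per-pair majorants
  `|ψψ·(77)| ≤ 2Kψ_T(j)ψ_T(k)[(2+|j|)²(1 + E_{j,j−1} + E_{j,j+1}) + (2+|k|)²(1 + E_{k,k−1} + E_{k,k+1})]`
  uniformly on a window;
* `RodgersTaoTruncHamiltonianAC.exists_zero_floor`, `exists_invSqSum_le`,
  `exists_abs_zero_le_linear` — the uniform window data (`|x_k(t)| ≥ δ`, `Σ_m 1/x_m(t)² ≤ S`,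
  `|x_k(t)| ≤ C(2+|k|)` from (50));
* `RodgersTaoTruncHamiltonianAC.exists_setIntegral_adjEnergy_le` — «finite thanks to Proposition 15»:
  `∫_{(t₁,t₂]} (E_{k,k−1} + E_{k,k+1}) dt ≤ C(2+|k|)³` for all `k ∈ ℤ*`, from the content twin
  `rodgers_tao_weak_energy_bound_of` of Prop. 15 (dyadic blocks `J = |k| − 1, |k|`; the phantom
  neighbour `x_0 = 0` through the floor `δ`);
* `RodgersTaoTruncHamiltonianAC.exists_setIntegral_adjEnergy_le'`,
  `ae_summable_truncWeight_pow_adjEnergy` — the same for all `k ∈ ℤ` (phantom index `0` included)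
  and its Tonelli consequence, the INTERFACE for the `x`-side of STAGE B: for `a ≤ 95` and a.e. `t`
  of the window, `Σ_k ψ_T(k)(2+|k|)^a(E_{k,k−1}(t) + E_{k,k+1}(t)) < ∞`;
* `RodgersTaoTruncHamiltonianAC.summable_integral_abs_weighted_oda` — **`hsum`**: the expression of
  the dominated-convergence step is finite, for every `T` with `T log T > 0`, on any window above a
  real-rooted time where (50) holds;
* `RodgersTaoTruncHamiltonianAC.truncHamiltonian_absolutelyContinuousOnInterval_of` /
  `…_eventually` — **STAGE A**: `H̃_T` is absolutely continuous on `[t₁, t₂]`,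
  `H̃_T(t) = H̃_T(t₁) + ∫_{t₁}^t D_T`, and `∂ₜH̃_T = D_T` a.e., where
  `D_T(s) = Σ_{j∼_T k} ψ_T(j)ψ_T(k)·(2Σ'_k − 2Σ'_j)/(x_j − x_k)` is the (77)-series (the absolute
  convergence of (69) at `t₁` is a hypothesis in `_of`, and Lemma 19's content twin
  `rodgers_tao_truncHamiltonian_expansion_of` in `_eventually`);
* `RodgersTaoTruncHamiltonianAC.tsum_weighted_oda_eq_of_summable`, `ae_summable_weighted_half`,
  `ae_formal_oda` — «desymmetrize in `j` and `k`»: wherever the half family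
  `ψ_T(j)ψ_T(k)·Σ'_k/(x_k − x_j)` is summable (which holds for a.e. `t` of the window, by the same
  integrated majorant), `D_T = −4 Σ_{j∼_T k} ψ_T(j)ψ_T(k)·Σ'_k/(x_k − x_j)`, the right-hand side of
  (78); hence (78) holds a.e. on the window, in the `volume.restrict (Icc t₁ t₂)`-a.e. `deriv` form
  used by the typed statement of Prop. 22;
* `RodgersTao2020.truncHamiltonian_absolutelyContinuousOnInterval_of_cor33_location` — the AS-PRINTED
  range version (window `[t₀/2, 0]` above a witness `t₀ < 0` with `H_{t₀}` real-rooted, from the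
  AS-PRINTED location law `RodgersTao2020.cor33_location`, itself a content theorem
  `RodgersTao2020.cor33_location_content`): `∃ T₁, ∀ T ≥ T₁`, `H̃_T` is absolutely continuous on
  `[t₀/2, 0]` and (78) holds for a.e. `t ∈ [t₀/2, 0]`.

## Divergences from print

(i) House time-translated form (cell ruling R2): an arbitrary window `[t₁, t₂]` above a real-rooted
time `t₀ < t₁` with (50) as an explicit hypothesis; the printed `Λ/2 ≤ t ≤ 0` is VACUOUS-AS-PRINTED
(`Λ ≥ 0`, `rodgers_tao_holds`). (ii) The «crude bound» is proved in a POLYNOMIAL form (in `|k|`,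
uniform in `t` on the window) instead of the printed `log₊^{O(1)}(k)`: the dominated-convergence step
only needs the FINITENESS of (79) for each fixed `T`, and `ψ_T(k) ≍ (|k|/(T log T))^{−100}` absorbs
polynomial losses; accordingly (52) and the count `(T+|k|)^{0.1}` of nearby indices are not used (the
majorant is summed over all pairs of `ℤ* × ℤ*`), and (50) enters only through `|x_k| ≪ 1 + |k|` and
through Prop. 15. (iii) The a.e. derivative is first obtained as the series `D_T` of the
(77)-terms (termwise FTC) and then desymmetrised into (78) wherever the half series converges
absolutely (a.e.); the main-term analysis giving (76) («`−4Ẽ_T` plus negligible terms», the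
`X₁ + X₂ + X₃ + X₄` decomposition of pp. 50–54) is STAGE B, not treated here.

LINE 1 — LABEL: RH-FREE CONTENT (0 facts); bears_on: N-C/N-P (COLUMN 3 DBN). WHAT THIS IS NOT: not
Proposition 22 (STAGE B remains), not a new route; `Λ ≥ 0` is already the tree theorem
`rodgers_tao_holds` (Dobner's route) and this module is one link of the optional by-content
Rodgers–Tao route (`RodgersTaoNonnegativityAssemblyProofs.lean`: residual {Prop. 22, Lemma 24,
`EnergyPropagationV5`}); the printed range is VACUOUS-AS-PRINTED; nothing here bears on the truth of
RH.

## References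

* [RodgersTaoFMP2020] B. Rodgers, T. Tao, *The de Bruijn–Newman constant is non-negative*, Forum
  Math. Pi 8 (2020), e6 — Prop. 22 p. 48 (76)–(78), proof pp. 49–50 ((79) and the two displays
  after it); Thm. 11 p. 27 (56); Lemma 12 (ii) p. 31; Prop. 15 p. 38; Cor. 10 (50) p. 23; §7 p. 42
  (66), p. 43 (69) (= arXiv:1801.05914v4 Prop. 7.7, Thm. 4.1, Lemma 4.2, Prop. 6.1, Cor. 3.3).
-/

noncomputable section

open Real Set Filter Topology MeasureTheory

namespace Literature.NumberTheory.LFunctions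

namespace RodgersTaoTruncHamiltonianAC

/-! ## §1 The principal-value velocity sum `Σ'_{i ≠ k} 1/(x_k − x_i)`: a crude bound -/

/-- The principal value sum in closed form above a real-rooted time:
`Σ'_{i ≠ k} 1/(x_k − x_i) = 1/(2x_k) + Σ_{m ≥ 1} 2x_k/(x_k² − x_m²)` (`k ∈ ℤ*`; the term `m = |k|`
reads `0`). [cite: RodgersTaoFMP2020, Thm. 11 p. 27 (56)] -/
theorem zeroVelocitySum_eq_tsum {t : ℝ} (hΛ : ∃ t₁ : ℝ, t₁ < t ∧ HasOnlyRealZeros (deBruijnH t₁))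
    {k : ℤ} (hk : k ≠ 0) :
    zeroVelocitySum t k = 1 / (2 * deBruijnZeroZ t k) +
      ∑' m : ℕ, 2 * deBruijnZeroZ t k / (deBruijnZeroZ t k ^ 2 - deBruijnZero t (m + 1) ^ 2) :=
  zeroVelocitySum_eq_of_tendsto (tendsto_zeroVelocityPartialSum hΛ hk)

/-- The adjacent-gap separation: for `i ≠ k` in `ℤ` (the index `0`, `x_0 = 0`, included),
`min(x_k − x_{k−1}, x_{k+1} − x_k) ≤ |x_k − x_i|` (the zeros are strictly increasing on `ℤ`).
[cite: RodgersTaoFMP2020, Prop. 22 p. 49 (proof, «crudely bound»)] -/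
theorem min_gap_le_abs_sub {t : ℝ} (hΛ : ∃ t₁ : ℝ, t₁ < t ∧ HasOnlyRealZeros (deBruijnH t₁))
    {i k : ℤ} (hik : i ≠ k) :
    min (deBruijnZeroZ t k - deBruijnZeroZ t (k - 1)) (deBruijnZeroZ t (k + 1) - deBruijnZeroZ t k) ≤
      |deBruijnZeroZ t k - deBruijnZeroZ t i| := by
  have hmono := strictMono_deBruijnZeroZ hΛ
  rcases lt_or_gt_of_ne hik with h | h
  · have h1 : deBruijnZeroZ t i ≤ deBruijnZeroZ t (k - 1) := hmono.monotone (by omega)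
    have h2 : deBruijnZeroZ t (k - 1) < deBruijnZeroZ t k := hmono (by omega)
    rw [abs_of_pos (by linarith)]
    exact (min_le_left _ _).trans (by linarith)
  · have h1 : deBruijnZeroZ t (k + 1) ≤ deBruijnZeroZ t i := hmono.monotone (by omega)
    have h2 : deBruijnZeroZ t k < deBruijnZeroZ t (k + 1) := hmono (by omega)
    rw [abs_of_neg (by linarith)]
    exact (min_le_right _ _).trans (by linarith)

/-- The adjacent gaps are positive above a real-rooted time.
[cite: RodgersTaoFMP2020, Prop. 22 p. 49 (proof, «crudely bound»)] -/
theorem min_gap_pos {t : ℝ} (hΛ : ∃ t₁ : ℝ, t₁ < t ∧ HasOnlyRealZeros (deBruijnH t₁)) (k : ℤ) :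
    0 < min (deBruijnZeroZ t k - deBruijnZeroZ t (k - 1))
      (deBruijnZeroZ t (k + 1) - deBruijnZeroZ t k) := by
  have hmono := strictMono_deBruijnZeroZ hΛ
  exact lt_min (sub_pos.2 (hmono (by omega))) (sub_pos.2 (hmono (by omega)))

/-- `1/min(u,v)² ≤ 1/u² + 1/v²` for positive `u, v`: the adjacent-gap energy dominates
`1/μ_k²`, i.e. `1/min(x_k − x_{k−1}, x_{k+1} − x_k)² ≤ E_{k,k−1} + E_{k,k+1}`.
[cite: RodgersTaoFMP2020, Prop. 22 p. 49 (proof, «crudely bound»)] -/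
theorem inv_min_gap_sq_le {t : ℝ} (hΛ : ∃ t₁ : ℝ, t₁ < t ∧ HasOnlyRealZeros (deBruijnH t₁))
    (k : ℤ) :
    1 / min (deBruijnZeroZ t k - deBruijnZeroZ t (k - 1))
        (deBruijnZeroZ t (k + 1) - deBruijnZeroZ t k) ^ 2 ≤
      interactionEnergy t k (k - 1) + interactionEnergy t k (k + 1) := by
  have hmono := strictMono_deBruijnZeroZ hΛ
  set u := deBruijnZeroZ t k - deBruijnZeroZ t (k - 1) with hu
  set v := deBruijnZeroZ t (k + 1) - deBruijnZeroZ t k with hv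
  have hu0 : 0 < u := sub_pos.2 (hmono (by omega))
  have hv0 : 0 < v := sub_pos.2 (hmono (by omega))
  have e1 : interactionEnergy t k (k - 1) = 1 / u ^ 2 := by rw [interactionEnergy_eq]
  have e2 : interactionEnergy t k (k + 1) = 1 / v ^ 2 := by
    rw [interactionEnergy_eq, hv, ← neg_sub, neg_sq]
  rw [e1, e2]
  rcases le_total u v with h | h
  · rw [min_eq_left h]
    have : 0 ≤ 1 / v ^ 2 := by positivity
    linarith
  · rw [min_eq_right h]
    have : 0 ≤ 1 / u ^ 2 := by positivity
    linarith

/-- The termwise majorant behind the crude bound: for `a, y, μ > 0` with `μ ≤ |a − y|` unless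
`y = a`, `|2a/(a² − y²)| ≤ (3a + 8a²/μ)/y²` (far regime `y ≥ 2a`: `|a² − y²| ≥ 3y²/4`; near
regime `y < 2a`: `|a² − y²| = |a − y|(a + y) ≥ μ a` and `1 ≤ 4a²/y²`; `y = a`: the term is `0`).
[cite: RodgersTaoFMP2020, Prop. 22 p. 49 (proof, «crudely bound»)] -/
theorem abs_velocity_term_le {a y μ : ℝ} (ha : 0 < a) (hy : 0 < y) (hμ : 0 < μ)
    (hsep : y ≠ a → μ ≤ |a - y|) :
    |2 * a / (a ^ 2 - y ^ 2)| ≤ (3 * a + 8 * a ^ 2 / μ) / y ^ 2 := by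
  have hR : 0 ≤ (3 * a + 8 * a ^ 2 / μ) / y ^ 2 := by positivity
  rcases eq_or_ne y a with rfl | hne
  · simpa using hR
  have hμ' := hsep hne
  have h82 : 0 ≤ 8 * a ^ 2 / μ := by positivity
  rcases le_or_gt (2 * a) y with hfar | hnear
  · -- far regime
    have h1 : a ^ 2 - y ^ 2 < 0 := by nlinarith
    rw [abs_div, abs_of_pos (by positivity : (0 : ℝ) < 2 * a), abs_of_neg h1]
    have h2 : 3 * y ^ 2 / 4 ≤ -(a ^ 2 - y ^ 2) := by nlinarith
    calc 2 * a / -(a ^ 2 - y ^ 2) ≤ 2 * a / (3 * y ^ 2 / 4) :=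
          div_le_div_of_nonneg_left (by positivity) (by positivity) h2
      _ = (8 * a / 3) / y ^ 2 := by field_simp; ring
      _ ≤ (3 * a + 8 * a ^ 2 / μ) / y ^ 2 := by
          gcongr
          linarith
  · -- near regime
    have h1 : |a ^ 2 - y ^ 2| = |a - y| * (a + y) := by
      rw [show a ^ 2 - y ^ 2 = (a - y) * (a + y) by ring, abs_mul,
        abs_of_pos (by positivity : 0 < a + y)]
    have h2 : μ * a ≤ |a ^ 2 - y ^ 2| := by
      rw [h1]
      exact mul_le_mul hμ' (by linarith) ha.le (abs_nonneg _)
    rw [abs_div, abs_of_pos (by positivity : (0 : ℝ) < 2 * a)]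
    have hy2 : y ^ 2 ≤ 4 * a ^ 2 := by nlinarith
    calc 2 * a / |a ^ 2 - y ^ 2| ≤ 2 * a / (μ * a) :=
          div_le_div_of_nonneg_left (by positivity) (by positivity) h2
      _ = 2 / μ := by field_simp
      _ ≤ (8 * a ^ 2 / μ) / y ^ 2 := by
          rw [le_div_iff₀ (by positivity), div_mul_eq_mul_div, le_div_iff₀ hμ,
            div_mul_cancel₀ _ hμ.ne']
          nlinarith
      _ ≤ (3 * a + 8 * a ^ 2 / μ) / y ^ 2 := by
          gcongr
          linarith

/-- **The crude bound for the principal-value velocity** (the «crudely bound» step of the proof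
of Prop. 22, FMP p. 49, in a polynomial form sufficient for the finiteness it serves): for
`t > Λ`, `k ∈ ℤ*` and any `μ > 0` separating `x_k` from all other `x_i`, `i ∈ ℤ`,
`|Σ'_{i ≠ k} 1/(x_k − x_i)| ≤ 1/(2|x_k|) + (3|x_k| + 8x_k²/μ) Σ_{m ≥ 1} 1/x_m²`. The printed
`≪ log₊^{O(1)} k (1/|x_k − x_{k−1}| + 1/|x_k − x_{k+1}|)` uses (50), (52); here only the closed form
of (56) and the convergence of `Σ_m 1/x_m²` are used.
[cite: RodgersTaoFMP2020, Prop. 22 p. 49 (proof, «crudely bound»)] -/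
theorem abs_zeroVelocitySum_le {t : ℝ} (hΛ : ∃ t₁ : ℝ, t₁ < t ∧ HasOnlyRealZeros (deBruijnH t₁))
    {k : ℤ} (hk : k ≠ 0) {μ : ℝ} (hμ : 0 < μ)
    (hsep : ∀ i : ℤ, i ≠ k → μ ≤ |deBruijnZeroZ t k - deBruijnZeroZ t i|) :
    |zeroVelocitySum t k| ≤ 1 / (2 * |deBruijnZeroZ t k|) +
      (3 * |deBruijnZeroZ t k| + 8 * deBruijnZeroZ t k ^ 2 / μ) *
        ∑' m : ℕ, 1 / deBruijnZero t (m + 1) ^ 2 := by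
  set a : ℝ := |deBruijnZeroZ t k| with ha
  have ha0 : 0 < a := abs_pos.2 (deBruijnZeroZ_ne_zero hΛ hk)
  have hS := summable_inv_deBruijnZero_sq hΛ
  have hV := summable_velocity_terms hΛ k
  rw [zeroVelocitySum_eq_tsum hΛ hk]
  -- the termwise majorant
  have hterm : ∀ m : ℕ,
      |2 * deBruijnZeroZ t k / (deBruijnZeroZ t k ^ 2 - deBruijnZero t (m + 1) ^ 2)| ≤
        (3 * a + 8 * a ^ 2 / μ) * (1 / deBruijnZero t (m + 1) ^ 2) := by
    intro m
    have hy : 0 < deBruijnZero t (m + 1) := deBruijnZero_pos hΛ (by omega)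
    have e1 : |2 * deBruijnZeroZ t k / (deBruijnZeroZ t k ^ 2 - deBruijnZero t (m + 1) ^ 2)| =
        |2 * a / (a ^ 2 - deBruijnZero t (m + 1) ^ 2)| := by
      rw [ha, sq_abs, abs_div, abs_div, abs_mul, abs_mul, abs_abs, abs_two]
    rw [e1, mul_one_div]
    refine abs_velocity_term_le ha0 hy hμ fun hne ↦ ?_
    -- separation: `x_{m+1} = x_i` with `i = m + 1` or `i = −(m+1)` according to the sign of `k`
    rcases lt_or_gt_of_ne hk with hneg | hpos
    · have hak : a = -deBruijnZeroZ t k := abs_of_neg (by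
        have := deBruijnZeroZ_pos hΛ (show 0 < -k by omega)
        rw [deBruijnZeroZ_neg] at this; linarith)
      have hi : (-((m + 1 : ℕ) : ℤ)) ≠ k := by
        intro h
        apply hne
        rw [hak, ← h, deBruijnZeroZ_neg_natCast, neg_neg]
      have := hsep _ hi
      rw [deBruijnZeroZ_neg_natCast] at this
      rw [hak, show -deBruijnZeroZ t k - deBruijnZero t (m + 1) =
        -(deBruijnZeroZ t k - -deBruijnZero t (m + 1)) by ring, abs_neg]
      exact this
    · have hak : a = deBruijnZeroZ t k := abs_of_pos (deBruijnZeroZ_pos hΛ hpos)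
      have hi : ((m + 1 : ℕ) : ℤ) ≠ k := by
        intro h
        apply hne
        rw [hak, ← h, deBruijnZeroZ_natCast]
      have := hsep _ hi
      rw [deBruijnZeroZ_natCast] at this
      rw [hak]
      exact this
  have h1 : |∑' m : ℕ, 2 * deBruijnZeroZ t k / (deBruijnZeroZ t k ^ 2 - deBruijnZero t (m + 1) ^ 2)|
      ≤ ∑' m : ℕ, |2 * deBruijnZeroZ t k / (deBruijnZeroZ t k ^ 2 - deBruijnZero t (m + 1) ^ 2)| := by
    have := norm_tsum_le_tsum_norm hV.norm
    simpa only [Real.norm_eq_abs] using this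
  have h2 : ∑' m : ℕ, |2 * deBruijnZeroZ t k / (deBruijnZeroZ t k ^ 2 - deBruijnZero t (m + 1) ^ 2)|
      ≤ ∑' m : ℕ, (3 * a + 8 * a ^ 2 / μ) * (1 / deBruijnZero t (m + 1) ^ 2) :=
    Summable.tsum_le_tsum hterm hV.abs (hS.mul_left _)
  rw [tsum_mul_left] at h2
  have h3 : |1 / (2 * deBruijnZeroZ t k)| = 1 / (2 * a) := by
    rw [ha, abs_div, abs_mul, abs_one, abs_two]
  have h4 := abs_add_le (1 / (2 * deBruijnZeroZ t k))
    (∑' m : ℕ, 2 * deBruijnZeroZ t k / (deBruijnZeroZ t k ^ 2 - deBruijnZero t (m + 1) ^ 2))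
  rw [h3] at h4
  have ha2 : a ^ 2 = deBruijnZeroZ t k ^ 2 := by rw [ha, sq_abs]
  rw [ha2] at h2
  linarith

/-! ## §2 The per-index and per-pair majorants -/

/-- **Per-index bound.** With uniform data `0 < δ ≤ |x_k| ≤ X` and `Σ_{m ≥ 1} 1/x_m² ≤ S`, the
principal-value velocity divided by the adjacent gap `μ_k = min(x_k − x_{k−1}, x_{k+1} − x_k)` obeys
`|Σ'_{i≠k} 1/(x_k − x_i)|/μ_k ≤ Φ/2 + (Φ/2 + Ψ)(E_{k,k−1} + E_{k,k+1})` with `Φ = 1/(2δ) + 3XS`,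
`Ψ = 8X²S` (from `abs_zeroVelocitySum_le`, `1/μ ≤ ½ + 1/(2μ²)` and `1/μ² ≤ E_{k,k−1} + E_{k,k+1}`).
[cite: RodgersTaoFMP2020, Prop. 22 p. 49 (proof, «crudely bound»)] -/
theorem abs_zeroVelocitySum_div_gap_le {t : ℝ}
    (hΛ : ∃ t₁ : ℝ, t₁ < t ∧ HasOnlyRealZeros (deBruijnH t₁)) {k : ℤ} (hk : k ≠ 0) {δ X S : ℝ}
    (hδ : 0 < δ) (hδk : δ ≤ |deBruijnZeroZ t k|) (hXk : |deBruijnZeroZ t k| ≤ X)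
    (hS : ∑' m : ℕ, 1 / deBruijnZero t (m + 1) ^ 2 ≤ S) :
    |zeroVelocitySum t k| /
        min (deBruijnZeroZ t k - deBruijnZeroZ t (k - 1)) (deBruijnZeroZ t (k + 1) - deBruijnZeroZ t k) ≤
      (1 / (2 * δ) + 3 * X * S) / 2 + ((1 / (2 * δ) + 3 * X * S) / 2 + 8 * X ^ 2 * S) *
        (interactionEnergy t k (k - 1) + interactionEnergy t k (k + 1)) := by
  set μ := min (deBruijnZeroZ t k - deBruijnZeroZ t (k - 1))
    (deBruijnZeroZ t (k + 1) - deBruijnZeroZ t k) with hμ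
  set a := |deBruijnZeroZ t k| with ha
  set S₀ := ∑' m : ℕ, 1 / deBruijnZero t (m + 1) ^ 2 with hS₀
  set G := interactionEnergy t k (k - 1) + interactionEnergy t k (k + 1) with hG
  set Φ := 1 / (2 * δ) + 3 * X * S with hΦ
  set Ψ := 8 * X ^ 2 * S with hΨ
  have hμ0 : 0 < μ := min_gap_pos hΛ k
  have ha0 : 0 < a := lt_of_lt_of_le hδ hδk
  have hX0 : 0 < X := ha0.trans_le hXk
  have hS₀0 : 0 ≤ S₀ := tsum_nonneg fun m ↦ by positivity
  have hS0 : 0 ≤ S := hS₀0.trans hS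
  have hΦ0 : 0 ≤ Φ := by positivity
  have hΨ0 : 0 ≤ Ψ := by positivity
  have hV := abs_zeroVelocitySum_le hΛ hk hμ0 (fun i hi ↦ min_gap_le_abs_sub hΛ hi)
  have ha2 : deBruijnZeroZ t k ^ 2 = a ^ 2 := by rw [ha, sq_abs]
  rw [ha2] at hV
  -- `|V| ≤ Φ + Ψ/μ`
  have hα : 1 / (2 * a) + 3 * a * S₀ ≤ Φ := by
    have h1 : 1 / (2 * a) ≤ 1 / (2 * δ) :=
      div_le_div_of_nonneg_left zero_le_one (by positivity) (by linarith)
    have h2 : 3 * a * S₀ ≤ 3 * X * S :=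
      mul_le_mul (by linarith) hS hS₀0 (by positivity)
    linarith
  have hβ : 8 * a ^ 2 * S₀ ≤ Ψ := by
    have : a ^ 2 ≤ X ^ 2 := pow_le_pow_left₀ ha0.le hXk 2
    exact mul_le_mul (by linarith) hS hS₀0 (by positivity)
  have hV' : |zeroVelocitySum t k| ≤ Φ + Ψ / μ := by
    calc |zeroVelocitySum t k| ≤ 1 / (2 * a) + (3 * a + 8 * a ^ 2 / μ) * S₀ := hV
      _ = (1 / (2 * a) + 3 * a * S₀) + 8 * a ^ 2 * S₀ / μ := by ring
      _ ≤ Φ + Ψ / μ := add_le_add hα (div_le_div_of_nonneg_right hβ hμ0.le)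
  -- divide by `μ`
  have hGμ : 1 / μ ^ 2 ≤ G := inv_min_gap_sq_le hΛ k
  have h1μ : 1 / μ ≤ 1 / 2 + (1 / μ ^ 2) / 2 := by
    have h := sq_nonneg (1 / μ - 1)
    have e : (1 / μ - 1) ^ 2 = 1 / μ ^ 2 - 2 * (1 / μ) + 1 := by ring
    rw [e] at h
    linarith
  calc |zeroVelocitySum t k| / μ ≤ (Φ + Ψ / μ) / μ := div_le_div_of_nonneg_right hV' hμ0.le
    _ = Φ * (1 / μ) + Ψ * (1 / μ ^ 2) := by
        field_simp
    _ ≤ Φ * (1 / 2 + G / 2) + Ψ * G := by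
        have h1 : 1 / μ ≤ 1 / 2 + G / 2 := by linarith
        exact add_le_add (mul_le_mul_of_nonneg_left h1 hΦ0) (mul_le_mul_of_nonneg_left hGμ hΨ0)
    _ = Φ / 2 + (Φ / 2 + Ψ) * G := by ring

/-- **Per-pair bound.** For distinct `j, k ∈ ℤ*` and `t > Λ`, the (oda) integrand of Prop. 22
satisfies `|(2Σ'_j − 2Σ'_k)/(x_j − x_k)| ≤ 2(|Σ'_j|/μ_j + |Σ'_k|/μ_k)`, `μ_i` the adjacent gap at
`i` (the printed «`1/|x_k − x_j| ≪ 1/|x_k − x_{k−1}| + 1/|x_k − x_{k+1}|`»).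
[cite: RodgersTaoFMP2020, Prop. 22 p. 49 (proof, «crudely bound»)] -/
theorem abs_oda_le {t : ℝ} (hΛ : ∃ t₁ : ℝ, t₁ < t ∧ HasOnlyRealZeros (deBruijnH t₁)) {j k : ℤ}
    (hjk : j ≠ k) :
    |-(2 * zeroVelocitySum t j - 2 * zeroVelocitySum t k) / (deBruijnZeroZ t j - deBruijnZeroZ t k)| ≤
      2 * (|zeroVelocitySum t j| /
          min (deBruijnZeroZ t j - deBruijnZeroZ t (j - 1)) (deBruijnZeroZ t (j + 1) - deBruijnZeroZ t j) +
        |zeroVelocitySum t k| /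
          min (deBruijnZeroZ t k - deBruijnZeroZ t (k - 1)) (deBruijnZeroZ t (k + 1) - deBruijnZeroZ t k)) := by
  set μj := min (deBruijnZeroZ t j - deBruijnZeroZ t (j - 1))
    (deBruijnZeroZ t (j + 1) - deBruijnZeroZ t j) with hμj
  set μk := min (deBruijnZeroZ t k - deBruijnZeroZ t (k - 1))
    (deBruijnZeroZ t (k + 1) - deBruijnZeroZ t k) with hμk
  have hμj0 : 0 < μj := min_gap_pos hΛ j
  have hμk0 : 0 < μk := min_gap_pos hΛ k
  set d := |deBruijnZeroZ t j - deBruijnZeroZ t k| with hd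
  have hdj : μj ≤ d := min_gap_le_abs_sub hΛ hjk.symm
  have hdk : μk ≤ d := by rw [hd, abs_sub_comm]; exact min_gap_le_abs_sub hΛ hjk
  have hd0 : 0 < d := hμj0.trans_le hdj
  rw [abs_div, ← hd, abs_neg]
  have hnum : |2 * zeroVelocitySum t j - 2 * zeroVelocitySum t k| ≤
      2 * |zeroVelocitySum t j| + 2 * |zeroVelocitySum t k| := by
    have := abs_sub (2 * zeroVelocitySum t j) (2 * zeroVelocitySum t k)
    simpa [abs_mul] using this
  calc |2 * zeroVelocitySum t j - 2 * zeroVelocitySum t k| / d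
      ≤ (2 * |zeroVelocitySum t j| + 2 * |zeroVelocitySum t k|) / d :=
        div_le_div_of_nonneg_right hnum hd0.le
    _ = 2 * (|zeroVelocitySum t j| / d + |zeroVelocitySum t k| / d) := by ring
    _ ≤ 2 * (|zeroVelocitySum t j| / μj + |zeroVelocitySum t k| / μk) := by
        gcongr

/-! ## §3 Uniform data on a compact time window above a real-rooted time -/

/-- A uniform floor for the zeros on a window `[t₁, t₂]` above a real-rooted time `t₀ < t₁`:
there is `δ > 0` with `δ ≤ |x_k(t)|` for all `t ∈ [t₁, t₂]` and `k ∈ ℤ*` (continuity of `x_1` on the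
compact window and `|x_k| = x_{|k|} ≥ x_1 > 0`). [cite: RodgersTaoFMP2020, Thm. 11 p. 27] -/
theorem exists_zero_floor {t₀ t₁ t₂ : ℝ} (hreal : HasOnlyRealZeros (deBruijnH t₀)) (h01 : t₀ < t₁) :
    ∃ δ : ℝ, 0 < δ ∧ ∀ t ∈ Icc t₁ t₂, ∀ k : ℤ, k ≠ 0 → δ ≤ |deBruijnZeroZ t k| := by
  have hΛ : ∀ t ∈ Icc t₁ t₂, ∃ t₁' : ℝ, t₁' < t ∧ HasOnlyRealZeros (deBruijnH t₁') :=
    fun t ht ↦ ⟨t₀, by linarith [ht.1], hreal⟩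
  -- `|x_k(t)| ≥ x_1(t)`
  have key : ∀ t ∈ Icc t₁ t₂, ∀ k : ℤ, k ≠ 0 → deBruijnZeroZ t 1 ≤ |deBruijnZeroZ t k| := by
    intro t ht k hk
    have hmono := strictMono_deBruijnZeroZ (hΛ t ht)
    rcases lt_or_gt_of_ne hk with h | h
    · have h1 : deBruijnZeroZ t 1 ≤ deBruijnZeroZ t (-k) := hmono.monotone (by omega)
      rw [deBruijnZeroZ_neg] at h1
      exact h1.trans (neg_le_abs _)
    · exact (hmono.monotone (show (1 : ℤ) ≤ k by omega)).trans (le_abs_self _)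
  rcases le_or_gt t₁ t₂ with h12 | h12
  · have hcont : ContinuousOn (fun t ↦ deBruijnZeroZ t 1) (Icc t₁ t₂) :=
      fun t ht ↦ (continuousAt_deBruijnZeroZ (hΛ t ht) 1).continuousWithinAt
    obtain ⟨s, hs, hmin⟩ :=
      isCompact_Icc.exists_isMinOn (nonempty_Icc.2 h12) hcont
    refine ⟨deBruijnZeroZ s 1, deBruijnZeroZ_pos (hΛ s hs) one_pos, fun t ht k hk ↦ ?_⟩
    exact (hmin ht).trans (key t ht k hk)
  · exact ⟨1, one_pos, fun t ht ↦ absurd (ht.1.trans ht.2) (not_le.2 h12)⟩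

/-- A uniform bound for `Σ_{m ≥ 1} 1/x_m(t)²` on a window `[t₁, t₂]` above a real-rooted time
`t₀ < t₁` (the series is continuous in `t` on `(t₀, ∞)`, Lemma 12 (ii)).
[cite: RodgersTaoFMP2020, Lemma 12 (ii) p. 31] -/
theorem exists_invSqSum_le {t₀ t₁ t₂ : ℝ} (hreal : HasOnlyRealZeros (deBruijnH t₀)) (h01 : t₀ < t₁) :
    ∃ S : ℝ, ∀ t ∈ Icc t₁ t₂, ∑' m : ℕ, 1 / deBruijnZero t (m + 1) ^ 2 ≤ S := by
  have hcont : ContinuousOn (fun t ↦ ∑' m : ℕ, 1 / deBruijnZero t (m + 1) ^ 2) (Icc t₁ t₂) :=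
    (continuousOn_tsum_inv_deBruijnZero_sq hreal).mono fun t ht ↦ lt_of_lt_of_le h01 ht.1
  obtain ⟨C, hC⟩ := isCompact_Icc.exists_bound_of_continuousOn hcont
  exact ⟨C, fun t ht ↦ (le_abs_self _).trans (by simpa [Real.norm_eq_abs] using hC t ht)⟩

/-- `log₊ x ≤ 1 + |x|`. [folklore] -/
private theorem logPlus_le_one_add_abs (x : ℝ) : logPlus x ≤ 1 + |x| := by
  rw [logPlus_eq]
  have := Real.log_le_sub_one_of_pos (by positivity : (0 : ℝ) < 2 + |x|)
  linarith

/-- Under the location law (50) on a window, the zeros grow at most linearly in the index,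
uniformly in time: `|x_k(t)| ≤ C(2 + |k|)` for `t ∈ [t₁, t₂]`, `k ∈ ℤ` (`|ξ_k| ≤ B_ξ|k|`,
`|x_k − ξ_k| ≤ B log₊ ξ_k ≤ B(1 + |ξ_k|)`).
[cite: RodgersTaoFMP2020, Corollary 10 (50) p. 23; Lemma 8 (43) p. 21] -/
theorem exists_abs_zero_le_linear {t₁ t₂ B : ℝ}
    (h50 : ∀ t ∈ Icc t₁ t₂, ∀ n : ℕ, 1 ≤ n →
      |deBruijnZero t n - classicalLocation (n : ℝ)| ≤ B * logPlus (classicalLocation (n : ℝ))) :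
    ∃ C : ℝ, 0 < C ∧ ∀ t ∈ Icc t₁ t₂, ∀ k : ℤ, |deBruijnZeroZ t k| ≤ C * (2 + |(k : ℝ)|) := by
  obtain ⟨Bξ, hBξ, h43⟩ := exists_abs_classicalLocationZ_le
  set B' : ℝ := max B 0 with hB'
  have hB'0 : 0 ≤ B' := le_max_right _ _
  refine ⟨Bξ + B' + B' * Bξ, by positivity, fun t ht k ↦ ?_⟩
  have h1 := abs_deBruijnZeroZ_sub_classicalLocationZ_le (h50 t ht) k
  have h2 := h43 k
  have h3 : logPlus (classicalLocationZ k) ≤ 1 + Bξ * |(k : ℝ)| :=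
    (logPlus_le_one_add_abs _).trans (by linarith)
  have h4 : |deBruijnZeroZ t k| ≤ |classicalLocationZ k| + |deBruijnZeroZ t k - classicalLocationZ k| := by
    have := abs_add_le (classicalLocationZ k) (deBruijnZeroZ t k - classicalLocationZ k)
    rwa [add_sub_cancel] at this
  have h5 : B' * logPlus (classicalLocationZ k) ≤ B' * (1 + Bξ * |(k : ℝ)|) :=
    mul_le_mul_of_nonneg_left h3 hB'0
  have hk0 : 0 ≤ |(k : ℝ)| := abs_nonneg _
  nlinarith [mul_nonneg hB'0 hk0, mul_nonneg hBξ.le hk0, mul_nonneg (mul_nonneg hB'0 hBξ.le) hk0]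

/-- `log₊ y ^ n ≤ C_n (2 + |y|)` for every natural `n` (any power of the logarithm is dominated by
a linear function: `log x ≤ n x^{1/n}` for `x ≥ 1`). [folklore] -/
private theorem exists_logPlus_pow_le_linear (n : ℕ) :
    ∃ C : ℝ, 0 < C ∧ ∀ y : ℝ, logPlus y ^ n ≤ C * (2 + |y|) := by
  rcases Nat.eq_zero_or_pos n with rfl | hn
  · refine ⟨1, one_pos, fun y ↦ ?_⟩
    have : 0 ≤ |y| := abs_nonneg y
    simp only [pow_zero]
    linarith
  refine ⟨(n : ℝ) ^ n, by positivity, fun y ↦ ?_⟩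
  have hx : (1 : ℝ) ≤ 2 + |y| := by have := abs_nonneg y; linarith
  have hx0 : (0 : ℝ) ≤ 2 + |y| := by linarith
  have hε : (0 : ℝ) < 1 / n := by positivity
  -- `log x ≤ x^{1/n} / (1/n) = n x^{1/n}`
  have h1 : Real.log (2 + |y|) ≤ (2 + |y|) ^ (1 / (n : ℝ)) / (1 / (n : ℝ)) :=
    Real.log_le_rpow_div hx0 hε
  have h2 : Real.log (2 + |y|) ≤ n * (2 + |y|) ^ (1 / (n : ℝ)) := by
    rw [div_div_eq_mul_div, div_one, mul_comm] at h1
    exact h1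
  have hlog0 : 0 ≤ Real.log (2 + |y|) := Real.log_nonneg hx
  rw [logPlus_eq]
  calc Real.log (2 + |y|) ^ n ≤ ((n : ℝ) * (2 + |y|) ^ (1 / (n : ℝ))) ^ n :=
        pow_le_pow_left₀ hlog0 h2 n
    _ = (n : ℝ) ^ n * ((2 + |y|) ^ (1 / (n : ℝ))) ^ n := mul_pow _ _ _
    _ = (n : ℝ) ^ n * (2 + |y|) := by
        congr 1
        rw [← Real.rpow_natCast, ← Real.rpow_mul hx0, one_div_mul_cancel (by positivity),
          Real.rpow_one]

/-- Polynomial absorption of the per-index constants: with `w ≥ 1`, `0 < δ`, `0 ≤ C_x`, `0 ≤ S`,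
`G ≥ 0` and `X = C_x w`, the quantity `Φ/2 + (Φ/2 + Ψ)G` of `abs_zeroVelocitySum_div_gap_le` is at
most `K w² (1 + G)` with `K = 1/δ + 6 C_x S + 16 C_x² S`. [folklore] -/
private theorem poly_absorb {δ Cx S w G : ℝ} (hδ : 0 < δ) (hCx : 0 ≤ Cx) (hS : 0 ≤ S) (hw : 1 ≤ w)
    (hG : 0 ≤ G) :
    (1 / (2 * δ) + 3 * (Cx * w) * S) / 2 +
        ((1 / (2 * δ) + 3 * (Cx * w) * S) / 2 + 8 * (Cx * w) ^ 2 * S) * G ≤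
      (1 / δ + 6 * Cx * S + 16 * Cx ^ 2 * S) * w ^ 2 * (1 + G) := by
  have hw2 : w ≤ w ^ 2 := by nlinarith
  have hw1 : 1 ≤ w ^ 2 := by nlinarith
  have h1 : 1 / (2 * δ) ≤ 1 / (2 * δ) * w ^ 2 := le_mul_of_one_le_right (by positivity) hw1
  have h2 : 3 * (Cx * w) * S ≤ 3 * Cx * S * w ^ 2 := by
    have := mul_le_mul_of_nonneg_left hw2 (by positivity : 0 ≤ 3 * Cx * S)
    linarith
  have hΦ : 1 / (2 * δ) + 3 * (Cx * w) * S ≤ (1 / (2 * δ) + 3 * Cx * S) * w ^ 2 := by linarith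
  have hΦ0 : 0 ≤ 1 / (2 * δ) + 3 * (Cx * w) * S := by
    have : 0 ≤ w := by linarith
    positivity
  have hΨ : 8 * (Cx * w) ^ 2 * S = 8 * Cx ^ 2 * S * w ^ 2 := by ring
  set Φ := 1 / (2 * δ) + 3 * (Cx * w) * S with hΦdef
  set K₁ := 1 / (2 * δ) + 3 * Cx * S with hK₁
  have hK₁0 : 0 ≤ K₁ := by positivity
  have hC80 : 0 ≤ 8 * Cx ^ 2 * S * w ^ 2 := by positivity
  calc Φ / 2 + (Φ / 2 + 8 * (Cx * w) ^ 2 * S) * G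
      ≤ K₁ * w ^ 2 + (K₁ * w ^ 2 + 8 * Cx ^ 2 * S * w ^ 2) * G := by
        rw [hΨ]
        have e1 : Φ / 2 ≤ K₁ * w ^ 2 := by linarith
        have e2 : (Φ / 2 + 8 * Cx ^ 2 * S * w ^ 2) * G ≤ (K₁ * w ^ 2 + 8 * Cx ^ 2 * S * w ^ 2) * G :=
          mul_le_mul_of_nonneg_right (by linarith) hG
        linarith
    _ ≤ (1 / δ + 6 * Cx * S + 16 * Cx ^ 2 * S) * w ^ 2 * (1 + G) := by
        have e : (1 / δ + 6 * Cx * S + 16 * Cx ^ 2 * S) = 2 * (K₁ + 8 * Cx ^ 2 * S) := by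
          rw [hK₁]; ring
        rw [e]
        nlinarith [mul_nonneg hK₁0 (le_trans zero_le_one hw1), mul_nonneg hC80 hG,
          mul_nonneg (mul_nonneg hK₁0 (le_trans zero_le_one hw1)) hG]

/-! ## §4 Integrated adjacent energies from Proposition 15 -/

/-- A single interaction energy `E_{ab}`, `1 ≤ a < b ≤ 2a`, is a term of the dyadic block sum
`Σ_{J ≤ j < k ≤ 2J} E_{jk}` of Prop. 15 with `J = a`. [cite: RodgersTaoFMP2020, Prop. 15 p. 38] -/
theorem interactionEnergy_le_dyadicSum (t : ℝ) {a b : ℤ} (ha : 1 ≤ a) (hab : a < b)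
    (hb : b ≤ 2 * a) :
    interactionEnergy t a b ≤ interactionEnergyDyadicSum t a := by
  rw [interactionEnergyDyadicSum_eq]
  have hce : ⌈((a : ℤ) : ℝ)⌉ = a := Int.ceil_intCast a
  have hfl : ⌊2 * ((a : ℤ) : ℝ)⌋ = 2 * a := by
    rw [show (2 : ℝ) * ((a : ℤ) : ℝ) = ((2 * a : ℤ) : ℝ) by push_cast; ring, Int.floor_intCast]
  have hmemA : a ∈ zstarIcc ⌈((a : ℤ) : ℝ)⌉ ⌊2 * ((a : ℤ) : ℝ)⌋ := by
    rw [hce, hfl, mem_zstarIcc]; omega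
  have hmemB : b ∈ (zstarIcc ⌈((a : ℤ) : ℝ)⌉ ⌊2 * ((a : ℤ) : ℝ)⌋).filter (fun k ↦ a < k) := by
    rw [Finset.mem_filter, hce, hfl, mem_zstarIcc]; omega
  calc interactionEnergy t a b
      ≤ ∑ k ∈ (zstarIcc ⌈((a : ℤ) : ℝ)⌉ ⌊2 * ((a : ℤ) : ℝ)⌋).filter (fun k ↦ a < k),
          interactionEnergy t a k :=
        Finset.single_le_sum (f := fun k ↦ interactionEnergy t a k)
          (fun k _ ↦ interactionEnergy_nonneg t a k) hmemB
    _ ≤ ∑ j ∈ zstarIcc ⌈((a : ℤ) : ℝ)⌉ ⌊2 * ((a : ℤ) : ℝ)⌋,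
          ∑ k ∈ (zstarIcc ⌈((a : ℤ) : ℝ)⌉ ⌊2 * ((a : ℤ) : ℝ)⌋).filter (fun k ↦ j < k),
            interactionEnergy t j k :=
        Finset.single_le_sum (f := fun j ↦
            ∑ k ∈ (zstarIcc ⌈((a : ℤ) : ℝ)⌉ ⌊2 * ((a : ℤ) : ℝ)⌋).filter (fun k ↦ j < k),
              interactionEnergy t j k)
          (fun j _ ↦ Finset.sum_nonneg fun k _ ↦ interactionEnergy_nonneg t j k) hmemA

/-- Every `E_{jk}(t)` is integrable on a window `(t₁, t₂]` above a real-rooted time `t₀ < t₁`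
(continuous on `[t₁, t₂]`). [cite: RodgersTaoFMP2020, §4 p. 29 (58)] -/
theorem integrableOn_interactionEnergy {t₀ t₁ t₂ : ℝ} (hreal : HasOnlyRealZeros (deBruijnH t₀))
    (h01 : t₀ < t₁) (j k : ℤ) :
    IntegrableOn (fun t ↦ interactionEnergy t j k) (Ioc t₁ t₂) :=
  ((RodgersTaoTruncEnergyIntegrable.continuousOn_interactionEnergy hreal h01 j k
    (t₂ := t₂)).integrableOn_Icc).mono_set Ioc_subset_Icc_self

/-- From Prop. 15 (content form): `∫_{(t₁,t₂]} E_{ab}(t) dt ≤ M₀ a² log₊^α a` for `1 ≤ a < b ≤ 2a`.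
[cite: RodgersTaoFMP2020, Prop. 15 = v4 Prop. 6.1 p. 38] -/
theorem setIntegral_interactionEnergy_le {t₀ t₁ t₂ M₀ : ℝ} {α : ℕ}
    (hreal : HasOnlyRealZeros (deBruijnH t₀)) (h01 : t₀ < t₁) (h12 : t₁ ≤ t₂)
    (hM : ∀ J : ℝ, 1 ≤ J →
      ∫ t in t₁..t₂, interactionEnergyDyadicSum t J ≤ M₀ * J ^ 2 * logPlus J ^ α)
    {a b : ℤ} (ha : 1 ≤ a) (hab : a < b) (hb : b ≤ 2 * a) :
    ∫ t in Ioc t₁ t₂, interactionEnergy t a b ≤ M₀ * ((a : ℤ) : ℝ) ^ 2 * logPlus ((a : ℤ) : ℝ) ^ α := by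
  have hI2 : IntegrableOn (fun t ↦ interactionEnergyDyadicSum t ((a : ℤ) : ℝ)) (Ioc t₁ t₂) :=
    ((continuousOn_interactionEnergyDyadicSum hreal h01 ((a : ℤ) : ℝ)
      (t₂ := t₂)).integrableOn_Icc).mono_set Ioc_subset_Icc_self
  have h1 := setIntegral_mono_on (integrableOn_interactionEnergy hreal h01 a b) hI2
    measurableSet_Ioc (fun t _ ↦ interactionEnergy_le_dyadicSum t ha hab hb)
  have h2 := hM ((a : ℤ) : ℝ) (by exact_mod_cast ha)
  rw [intervalIntegral.integral_of_le h12] at h2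
  exact h1.trans h2

/-- The adjacent-gap energy `E_{k,k−1} + E_{k,k+1}` is even in `k` (`x_{−j} = −x_j`).
[cite: RodgersTaoFMP2020, §4 p. 29 (58)] -/
theorem adjEnergy_neg (t : ℝ) (k : ℤ) :
    interactionEnergy t (-k) (-k - 1) + interactionEnergy t (-k) (-k + 1) =
      interactionEnergy t k (k - 1) + interactionEnergy t k (k + 1) := by
  have h1 := RodgersTaoTruncEnergyIntegrable.interactionEnergy_neg_neg t k (k + 1)
  have h2 := RodgersTaoTruncEnergyIntegrable.interactionEnergy_neg_neg t k (k - 1)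
  rw [show -k - 1 = -(k + 1) by ring, show -k + 1 = -(k - 1) by ring, h1, h2, add_comm]

/-- `∫_{(t₁,t₂]} (1 + u) ≤ (t₂ − t₁) + I` when `∫_{(t₁,t₂]} u ≤ I`. [folklore] -/
private theorem setIntegral_one_add_le {t₁ t₂ I : ℝ} (h12 : t₁ ≤ t₂) {u : ℝ → ℝ}
    (hu : IntegrableOn u (Ioc t₁ t₂)) (hI : ∫ t in Ioc t₁ t₂, u t ≤ I) :
    ∫ t in Ioc t₁ t₂, (1 + u t) ≤ (t₂ - t₁) + I := by
  have hc : IntegrableOn (fun _ : ℝ ↦ (1 : ℝ)) (Ioc t₁ t₂) :=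
    integrableOn_const (by exact measure_Ioc_lt_top.ne)
  rw [integral_add hc hu, setIntegral_const, Real.volume_real_Ioc_of_le h12, smul_eq_mul, mul_one]
  linarith

/-- **Integrated adjacent energies are polynomially bounded** on a window above a real-rooted time
under the location law (50): there is `C ≥ 0` with
`∫_{(t₁,t₂]} (E_{k,k−1} + E_{k,k+1})(t) dt ≤ C (2 + |k|)³` for all `k ∈ ℤ*` (Prop. 15 in its content
form `rodgers_tao_weak_energy_bound_of` on the dyadic blocks `J = |k| − 1, |k|`, `log₊^α ≪_α` linear,
and the uniform floor `|x_{±1}| ≥ δ` for the phantom neighbour `x_0 = 0`).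
[cite: RodgersTaoFMP2020, Prop. 22 p. 48, proof p. 50 («finite thanks to Proposition 15 and (66)»); Prop. 15 p. 38] -/
theorem exists_setIntegral_adjEnergy_le {t₀ t₁ t₂ B : ℝ} (hreal : HasOnlyRealZeros (deBruijnH t₀))
    (h01 : t₀ < t₁) (h12 : t₁ < t₂)
    (h50 : ∀ t ∈ Icc t₁ t₂, ∀ n : ℕ, 1 ≤ n →
      |deBruijnZero t n - classicalLocation (n : ℝ)| ≤ B * logPlus (classicalLocation (n : ℝ))) :
    ∃ C : ℝ, 0 ≤ C ∧ ∀ k : ℤ, k ≠ 0 →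
      IntegrableOn (fun t ↦ interactionEnergy t k (k - 1) + interactionEnergy t k (k + 1))
          (Ioc t₁ t₂) ∧
        ∫ t in Ioc t₁ t₂, (interactionEnergy t k (k - 1) + interactionEnergy t k (k + 1)) ≤
          C * (2 + |(k : ℝ)|) ^ 3 := by
  obtain ⟨M₀, α, hM₀, hM⟩ := rodgers_tao_weak_energy_bound_of hreal h01 h12 h50
  obtain ⟨Cα, hCα, hlog⟩ := exists_logPlus_pow_le_linear α
  obtain ⟨δ, hδ, hfloor⟩ := exists_zero_floor hreal h01 (t₂ := t₂)
  set L := t₂ - t₁ with hL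
  have hL0 : 0 ≤ L := by rw [hL]; linarith
  have hInt := fun j k ↦ integrableOn_interactionEnergy hreal h01 j k (t₂ := t₂)
  -- the dyadic bound in polynomial form
  have hdy : ∀ a b : ℤ, 1 ≤ a → a < b → b ≤ 2 * a →
      ∫ t in Ioc t₁ t₂, interactionEnergy t a b ≤ M₀ * Cα * (2 + ((a : ℤ) : ℝ)) ^ 3 := by
    intro a b ha hab hb
    have h := setIntegral_interactionEnergy_le hreal h01 h12.le hM ha hab hb
    have ha0 : (0 : ℝ) ≤ ((a : ℤ) : ℝ) := by exact_mod_cast (show (0 : ℤ) ≤ a by omega)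
    have h2 : logPlus ((a : ℤ) : ℝ) ^ α ≤ Cα * (2 + ((a : ℤ) : ℝ)) := by
      have := hlog ((a : ℤ) : ℝ)
      rwa [abs_of_nonneg ha0] at this
    have h3 : ((a : ℤ) : ℝ) ^ 2 ≤ (2 + ((a : ℤ) : ℝ)) ^ 2 := pow_le_pow_left₀ ha0 (by linarith) 2
    calc ∫ t in Ioc t₁ t₂, interactionEnergy t a b
        ≤ M₀ * ((a : ℤ) : ℝ) ^ 2 * logPlus ((a : ℤ) : ℝ) ^ α := h
      _ ≤ M₀ * ((a : ℤ) : ℝ) ^ 2 * (Cα * (2 + ((a : ℤ) : ℝ))) :=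
          mul_le_mul_of_nonneg_left h2 (by positivity)
      _ ≤ M₀ * (2 + ((a : ℤ) : ℝ)) ^ 2 * (Cα * (2 + ((a : ℤ) : ℝ))) :=
          mul_le_mul_of_nonneg_right (mul_le_mul_of_nonneg_left h3 hM₀) (by positivity)
      _ = M₀ * Cα * (2 + ((a : ℤ) : ℝ)) ^ 3 := by ring
  -- the phantom-neighbour term `E_{1,0} = 1/x_1²`
  have h10 : ∫ t in Ioc t₁ t₂, interactionEnergy t 1 0 ≤ L / δ ^ 2 := by
    have hpt : ∀ t ∈ Ioc t₁ t₂, interactionEnergy t 1 0 ≤ 1 / δ ^ 2 := by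
      intro t ht
      have hk := hfloor t ⟨ht.1.le, ht.2⟩ 1 one_ne_zero
      rw [interactionEnergy_eq, deBruijnZeroZ_zero, sub_zero]
      have : δ ^ 2 ≤ deBruijnZeroZ t 1 ^ 2 := by
        rw [← sq_abs (deBruijnZeroZ t 1)]; exact pow_le_pow_left₀ hδ.le hk 2
      exact div_le_div_of_nonneg_left zero_le_one (by positivity) this
    have hc : IntegrableOn (fun _ : ℝ ↦ (1 / δ ^ 2 : ℝ)) (Ioc t₁ t₂) :=
      integrableOn_const (by exact measure_Ioc_lt_top.ne)
    calc ∫ t in Ioc t₁ t₂, interactionEnergy t 1 0 ≤ ∫ t in Ioc t₁ t₂, (1 / δ ^ 2 : ℝ) :=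
          setIntegral_mono_on (hInt 1 0) hc measurableSet_Ioc hpt
      _ = L / δ ^ 2 := by
          rw [setIntegral_const, Real.volume_real_Ioc_of_le h12.le, smul_eq_mul, hL]; ring
  -- positive indices
  have hpos : ∀ k : ℤ, 0 < k →
      ∫ t in Ioc t₁ t₂, (interactionEnergy t k (k - 1) + interactionEnergy t k (k + 1)) ≤
        (2 * (M₀ * Cα) + L / δ ^ 2) * (2 + ((k : ℤ) : ℝ)) ^ 3 := by
    intro k hk
    rw [integral_add (hInt k (k - 1)) (hInt k (k + 1))]
    have hk0 : (0 : ℝ) ≤ ((k : ℤ) : ℝ) := by exact_mod_cast hk.le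
    have hw1 : (1 : ℝ) ≤ (2 + ((k : ℤ) : ℝ)) ^ 3 := by
      have : (1 : ℝ) ≤ 2 + ((k : ℤ) : ℝ) := by linarith
      exact one_le_pow₀ this
    have hMC : 0 ≤ M₀ * Cα := mul_nonneg hM₀ hCα.le
    have hR : ∫ t in Ioc t₁ t₂, interactionEnergy t k (k + 1) ≤ M₀ * Cα * (2 + ((k : ℤ) : ℝ)) ^ 3 :=
      hdy k (k + 1) (by omega) (by omega) (by omega)
    have hLft : ∫ t in Ioc t₁ t₂, interactionEnergy t k (k - 1) ≤
        M₀ * Cα * (2 + ((k : ℤ) : ℝ)) ^ 3 + L / δ ^ 2 * (2 + ((k : ℤ) : ℝ)) ^ 3 := by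
      rcases eq_or_lt_of_le (show (1 : ℤ) ≤ k by omega) with h1 | h2
      · subst h1
        have e : ((1 : ℤ) - 1 : ℤ) = 0 := by norm_num
        rw [e]
        have hA : 0 ≤ M₀ * Cα * (2 + (((1 : ℤ) : ℤ) : ℝ)) ^ 3 := by positivity
        have hB : L / δ ^ 2 ≤ L / δ ^ 2 * (2 + (((1 : ℤ) : ℤ) : ℝ)) ^ 3 :=
          le_mul_of_one_le_right (by positivity) hw1
        linarith [h10]
      · have hc : (fun t ↦ interactionEnergy t k (k - 1)) = fun t ↦ interactionEnergy t (k - 1) k :=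
          funext fun t ↦ interactionEnergy_comm t k (k - 1)
        rw [hc]
        have h := hdy (k - 1) k (by omega) (by omega) (by omega)
        have hmono : (2 + (((k - 1 : ℤ) : ℤ) : ℝ)) ^ 3 ≤ (2 + ((k : ℤ) : ℝ)) ^ 3 := by
          push_cast
          exact pow_le_pow_left₀ (by linarith) (by linarith) 3
        have hB : 0 ≤ L / δ ^ 2 * (2 + ((k : ℤ) : ℝ)) ^ 3 := by positivity
        nlinarith [mul_le_mul_of_nonneg_left hmono hMC]
    nlinarith [hR, hLft]
  refine ⟨2 * (M₀ * Cα) + L / δ ^ 2, by positivity, fun k hk ↦ ⟨(hInt k (k - 1)).add (hInt k (k + 1)), ?_⟩⟩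
  rcases lt_or_gt_of_ne hk with hneg | hkpos
  · -- negative index: reduce to `−k > 0`
    have e : (fun t ↦ interactionEnergy t k (k - 1) + interactionEnergy t k (k + 1)) =
        fun t ↦ interactionEnergy t (-k) (-k - 1) + interactionEnergy t (-k) (-k + 1) := by
      funext t
      have := adjEnergy_neg t (-k)
      simp only [neg_neg] at this
      exact this
    rw [e]
    have h := hpos (-k) (by omega)
    have habs : |(k : ℝ)| = (((-k : ℤ) : ℤ) : ℝ) := by
      push_cast
      exact abs_of_neg (by exact_mod_cast hneg)
    rw [habs]
    exact h
  · have habs : |(k : ℝ)| = ((k : ℤ) : ℝ) := abs_of_pos (by exact_mod_cast hkpos)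
    rw [habs]
    exact hpos k hkpos

/-- The same polynomial bound for ALL `k ∈ ℤ`, the phantom index `k = 0` (`x_0 = 0`,
`E_{0,∓1} = 1/x_1²`) being covered by the uniform floor. [cite: RodgersTaoFMP2020, Prop. 22 p. 48, proof p. 50 («finite thanks to Proposition 15 and (66)»); Prop. 15 p. 38] -/
theorem exists_setIntegral_adjEnergy_le' {t₀ t₁ t₂ B : ℝ} (hreal : HasOnlyRealZeros (deBruijnH t₀))
    (h01 : t₀ < t₁) (h12 : t₁ < t₂)
    (h50 : ∀ t ∈ Icc t₁ t₂, ∀ n : ℕ, 1 ≤ n →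
      |deBruijnZero t n - classicalLocation (n : ℝ)| ≤ B * logPlus (classicalLocation (n : ℝ))) :
    ∃ C : ℝ, 0 ≤ C ∧ ∀ k : ℤ,
      IntegrableOn (fun t ↦ interactionEnergy t k (k - 1) + interactionEnergy t k (k + 1))
          (Ioc t₁ t₂) ∧
        ∫ t in Ioc t₁ t₂, (interactionEnergy t k (k - 1) + interactionEnergy t k (k + 1)) ≤
          C * (2 + |(k : ℝ)|) ^ 3 := by
  obtain ⟨C, hC, hk⟩ := exists_setIntegral_adjEnergy_le hreal h01 h12 h50
  obtain ⟨δ, hδ, hfloor⟩ := exists_zero_floor hreal h01 (t₂ := t₂)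
  have hInt := fun j k ↦ integrableOn_interactionEnergy hreal h01 j k (t₂ := t₂)
  -- the phantom index: `E_{0,−1} + E_{0,1} ≤ 2/δ²`
  have h0 : ∫ t in Ioc t₁ t₂, (interactionEnergy t 0 (0 - 1) + interactionEnergy t 0 (0 + 1)) ≤
      2 * (t₂ - t₁) / δ ^ 2 := by
    have hpt : ∀ t ∈ Ioc t₁ t₂,
        interactionEnergy t 0 (0 - 1) + interactionEnergy t 0 (0 + 1) ≤ 2 / δ ^ 2 := by
      intro t ht
      have h1 := hfloor t ⟨ht.1.le, ht.2⟩ 1 one_ne_zero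
      have e1 : interactionEnergy t 0 (0 - 1) = 1 / deBruijnZeroZ t 1 ^ 2 := by
        rw [interactionEnergy_eq, deBruijnZeroZ_zero, show (0 : ℤ) - 1 = -1 by norm_num,
          deBruijnZeroZ_neg]; ring
      have e2 : interactionEnergy t 0 (0 + 1) = 1 / deBruijnZeroZ t 1 ^ 2 := by
        rw [interactionEnergy_eq, deBruijnZeroZ_zero, zero_add]; ring
      have h2 : δ ^ 2 ≤ deBruijnZeroZ t 1 ^ 2 := by
        rw [← sq_abs (deBruijnZeroZ t 1)]; exact pow_le_pow_left₀ hδ.le h1 2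
      have h3 : 1 / deBruijnZeroZ t 1 ^ 2 ≤ 1 / δ ^ 2 :=
        div_le_div_of_nonneg_left zero_le_one (by positivity) h2
      have h4 : (2 : ℝ) / δ ^ 2 = 1 / δ ^ 2 + 1 / δ ^ 2 := by ring
      rw [e1, e2, h4]
      exact add_le_add h3 h3
    have hc : IntegrableOn (fun _ : ℝ ↦ (2 / δ ^ 2 : ℝ)) (Ioc t₁ t₂) :=
      integrableOn_const (by exact measure_Ioc_lt_top.ne)
    calc ∫ t in Ioc t₁ t₂, (interactionEnergy t 0 (0 - 1) + interactionEnergy t 0 (0 + 1))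
        ≤ ∫ t in Ioc t₁ t₂, (2 / δ ^ 2 : ℝ) :=
          setIntegral_mono_on ((hInt 0 (0 - 1)).add (hInt 0 (0 + 1))) hc measurableSet_Ioc hpt
      _ = 2 * (t₂ - t₁) / δ ^ 2 := by
          rw [setIntegral_const, Real.volume_real_Ioc_of_le h12.le, smul_eq_mul]; ring
  have hL0 : 0 ≤ t₂ - t₁ := by linarith
  have hL : 0 ≤ 2 * (t₂ - t₁) / δ ^ 2 := by positivity
  refine ⟨C + 2 * (t₂ - t₁) / δ ^ 2, by positivity,
    fun k ↦ ⟨(hInt k (k - 1)).add (hInt k (k + 1)), ?_⟩⟩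
  have hw : (1 : ℝ) ≤ (2 + |(k : ℝ)|) ^ 3 := one_le_pow₀ (by have := abs_nonneg (k : ℝ); linarith)
  rcases eq_or_ne k 0 with rfl | hk0
  · have e : |((0 : ℤ) : ℝ)| = 0 := by simp
    have h1 : 2 * (t₂ - t₁) / δ ^ 2 ≤ (C + 2 * (t₂ - t₁) / δ ^ 2) * (2 + |((0 : ℤ) : ℝ)|) ^ 3 := by
      rw [e]; nlinarith
    exact h0.trans h1
  · have h1 := (hk k hk0).2
    have h2 : C * (2 + |(k : ℝ)|) ^ 3 ≤ (C + 2 * (t₂ - t₁) / δ ^ 2) * (2 + |(k : ℝ)|) ^ 3 :=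
      mul_le_mul_of_nonneg_right (by linarith) (by positivity)
    exact h1.trans h2

/-- **Interface for the `x`-side of STAGE B** (X₂, X₃ − X′₃, X₄ of pp. 50–54): for every `a ≤ 95`,
at almost every time `t` of a window above a real-rooted time where (50) holds, the weighted
adjacent energies are summable: `Σ_{k ∈ ℤ} ψ_T(k)(2+|k|)^a (E_{k,k−1}(t) + E_{k,k+1}(t)) < ∞` (Tonelli
over the integrated bound `exists_setIntegral_adjEnergy_le'` and `Σ_k ψ_T(k)(2+|k|)^{a+3} < ∞`, (66)).
Every `1/|x_k − x_j|²`, `j ≠ k`, is at most this adjacent energy (`inv_min_gap_sq_le`,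
`min_gap_le_abs_sub`), which is how «moderately sized» sums with unbounded nearby multiplicities are
controlled at a.e. `t`. [cite: RodgersTaoFMP2020, Prop. 22 p. 48, proof p. 50 («the integrand is absolutely integrable in time»); Prop. 15 p. 38] -/
theorem ae_summable_truncWeight_pow_adjEnergy {t₀ t₁ t₂ B : ℝ}
    (hreal : HasOnlyRealZeros (deBruijnH t₀)) (h01 : t₀ < t₁) (h12 : t₁ < t₂)
    (h50 : ∀ t ∈ Icc t₁ t₂, ∀ n : ℕ, 1 ≤ n →
      |deBruijnZero t n - classicalLocation (n : ℝ)| ≤ B * logPlus (classicalLocation (n : ℝ)))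
    {T : ℝ} (hT : 0 < T * Real.log T) {a : ℕ} (ha : a ≤ 95) :
    ∀ᵐ t ∂(volume.restrict (Icc t₁ t₂)),
      Summable fun k : ℤ ↦ truncWeight T k * (2 + |(k : ℝ)|) ^ a *
        (interactionEnergy t k (k - 1) + interactionEnergy t k (k + 1)) := by
  obtain ⟨C, hC, hk⟩ := exists_setIntegral_adjEnergy_le' hreal h01 h12 h50
  have hψ0 : ∀ i, 0 ≤ truncWeight T i := fun i ↦ (truncWeight_pos hT i).le
  have hnn : ∀ k : ℤ, ∀ t, 0 ≤ truncWeight T k * (2 + |(k : ℝ)|) ^ a *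
      (interactionEnergy t k (k - 1) + interactionEnergy t k (k + 1)) := fun k t ↦
    mul_nonneg (mul_nonneg (hψ0 k) (by positivity))
      (add_nonneg (interactionEnergy_nonneg _ _ _) (interactionEnergy_nonneg _ _ _))
  have hInt : ∀ k : ℤ, Integrable (fun t ↦ truncWeight T k * (2 + |(k : ℝ)|) ^ a *
      (interactionEnergy t k (k - 1) + interactionEnergy t k (k + 1))) (volume.restrict (Ioc t₁ t₂)) :=
    fun k ↦ (hk k).1.const_mul _
  have hsum : Summable fun k : ℤ ↦ ∫ t in Ioc t₁ t₂, |truncWeight T k * (2 + |(k : ℝ)|) ^ a *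
      (interactionEnergy t k (k - 1) + interactionEnergy t k (k + 1))| := by
    have hmaj : Summable fun k : ℤ ↦ C * (truncWeight T k * (2 + |(k : ℝ)|) ^ (a + 3)) :=
      (RodgersTaoTruncEnergyIntegrable.summable_truncWeight_mul_pow hT (by omega)).mul_left C
    refine Summable.of_nonneg_of_le (fun k ↦ integral_nonneg fun t ↦ abs_nonneg _) (fun k ↦ ?_) hmaj
    have e : (fun t ↦ |truncWeight T k * (2 + |(k : ℝ)|) ^ a *
        (interactionEnergy t k (k - 1) + interactionEnergy t k (k + 1))|) = fun t ↦
        truncWeight T k * (2 + |(k : ℝ)|) ^ a *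
          (interactionEnergy t k (k - 1) + interactionEnergy t k (k + 1)) :=
      funext fun t ↦ abs_of_nonneg (hnn k t)
    rw [e, integral_const_mul]
    calc truncWeight T k * (2 + |(k : ℝ)|) ^ a *
          ∫ t in Ioc t₁ t₂, (interactionEnergy t k (k - 1) + interactionEnergy t k (k + 1))
        ≤ truncWeight T k * (2 + |(k : ℝ)|) ^ a * (C * (2 + |(k : ℝ)|) ^ 3) :=
          mul_le_mul_of_nonneg_left (hk k).2 (mul_nonneg (hψ0 k) (by positivity))
      _ = C * (truncWeight T k * (2 + |(k : ℝ)|) ^ (a + 3)) := by ring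
  have h := (RodgersTaoSeriesAbsContinuity.integrable_tsum_of_summable_integral_abs
    (μ := volume.restrict (Ioc t₁ t₂)) hInt hsum).1
  rw [Measure.restrict_congr_set Ioc_ae_eq_Icc] at h
  filter_upwards [h] with t ht
  exact (summable_abs_iff).1 ht

/-! ## §5 `hsum`: the dominated-convergence hypothesis of Proposition 22 -/

/-- **The pointwise majorant of the weighted (oda) integrand** on a window above a real-rooted
time: with the uniform data `δ ≤ |x_i| ≤ C_x(2 + |i|)`, `Σ_m 1/x_m² ≤ S`, for every pair of
distinct `j, k ∈ ℤ*`,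
`|ψ_T(j)ψ_T(k) (2Σ'_k − 2Σ'_j)/(x_j − x_k)| ≤ 2K ψ_T(j)ψ_T(k) [(2+|j|)²(1 + G_j) + (2+|k|)²(1 + G_k)]`,
`G_i = E_{i,i−1} + E_{i,i+1}`, `K = 1/δ + 6C_xS + 16C_x²S`.
[cite: RodgersTaoFMP2020, Prop. 22 p. 49 (proof, «crudely bound»)] -/
theorem abs_weighted_oda_le {t : ℝ} (hΛ : ∃ t₁ : ℝ, t₁ < t ∧ HasOnlyRealZeros (deBruijnH t₁))
    {δ Cx S : ℝ} (hδ : 0 < δ) (hCx : 0 ≤ Cx) (hS : 0 ≤ S)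
    (hfloor : ∀ i : ℤ, i ≠ 0 → δ ≤ |deBruijnZeroZ t i|)
    (hlin : ∀ i : ℤ, |deBruijnZeroZ t i| ≤ Cx * (2 + |(i : ℝ)|))
    (hSt : ∑' m : ℕ, 1 / deBruijnZero t (m + 1) ^ 2 ≤ S)
    {T : ℝ} (hT : 0 < T * Real.log T) {j k : ℤ} (hj : j ≠ 0) (hk : k ≠ 0) (hjk : j ≠ k) :
    |truncWeight T j * truncWeight T k *
        (-(2 * zeroVelocitySum t j - 2 * zeroVelocitySum t k) /
          (deBruijnZeroZ t j - deBruijnZeroZ t k))| ≤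
      2 * (1 / δ + 6 * Cx * S + 16 * Cx ^ 2 * S) * (truncWeight T j * truncWeight T k) *
        ((2 + |(j : ℝ)|) ^ 2 * (1 + (interactionEnergy t j (j - 1) + interactionEnergy t j (j + 1))) +
          (2 + |(k : ℝ)|) ^ 2 *
            (1 + (interactionEnergy t k (k - 1) + interactionEnergy t k (k + 1)))) := by
  set K := 1 / δ + 6 * Cx * S + 16 * Cx ^ 2 * S with hK
  have hψ : 0 ≤ truncWeight T j * truncWeight T k :=
    mul_nonneg (truncWeight_pos hT j).le (truncWeight_pos hT k).le
  have hGj : 0 ≤ interactionEnergy t j (j - 1) + interactionEnergy t j (j + 1) :=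
    add_nonneg (interactionEnergy_nonneg _ _ _) (interactionEnergy_nonneg _ _ _)
  have hGk : 0 ≤ interactionEnergy t k (k - 1) + interactionEnergy t k (k + 1) :=
    add_nonneg (interactionEnergy_nonneg _ _ _) (interactionEnergy_nonneg _ _ _)
  have hwj : (1 : ℝ) ≤ 2 + |(j : ℝ)| := by have := abs_nonneg (j : ℝ); linarith
  have hwk : (1 : ℝ) ≤ 2 + |(k : ℝ)| := by have := abs_nonneg (k : ℝ); linarith
  -- per-index bounds
  have hVj := abs_zeroVelocitySum_div_gap_le hΛ hj hδ (hfloor j hj) (hlin j) hSt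
  have hVk := abs_zeroVelocitySum_div_gap_le hΛ hk hδ (hfloor k hk) (hlin k) hSt
  have hPj := poly_absorb hδ hCx hS hwj hGj
  have hPk := poly_absorb hδ hCx hS hwk hGk
  have hoda := abs_oda_le hΛ hjk
  rw [abs_mul, abs_of_nonneg hψ]
  calc truncWeight T j * truncWeight T k *
        |-(2 * zeroVelocitySum t j - 2 * zeroVelocitySum t k) / (deBruijnZeroZ t j - deBruijnZeroZ t k)|
      ≤ truncWeight T j * truncWeight T k *
          (2 * (K * (2 + |(j : ℝ)|) ^ 2 * (1 + (interactionEnergy t j (j - 1) + interactionEnergy t j (j + 1))) +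
            K * (2 + |(k : ℝ)|) ^ 2 * (1 + (interactionEnergy t k (k - 1) + interactionEnergy t k (k + 1))))) := by
        refine mul_le_mul_of_nonneg_left (hoda.trans ?_) hψ
        gcongr
        · exact hVj.trans hPj
        · exact hVk.trans hPk
    _ = _ := by ring

/-- `∫_{(t₁,t₂]} c(A(1 + u) + B(1 + v)) = c(A∫(1 + u) + B∫(1 + v))` for integrable `1 + u`, `1 + v`.
[folklore] -/
private theorem setIntegral_majorant_eq {t₁ t₂ : ℝ} (c A B : ℝ) {u v : ℝ → ℝ}
    (hu : IntegrableOn (fun s ↦ 1 + u s) (Ioc t₁ t₂)) (hv : IntegrableOn (fun s ↦ 1 + v s) (Ioc t₁ t₂)) :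
    ∫ s in Ioc t₁ t₂, c * (A * (1 + u s) + B * (1 + v s)) =
      c * (A * (∫ s in Ioc t₁ t₂, (1 + u s)) + B * (∫ s in Ioc t₁ t₂, (1 + v s))) := by
  rw [integral_const_mul, integral_add (hu.const_mul A) (hv.const_mul B), integral_const_mul,
    integral_const_mul]

/-- **The integrated majorant for one nearby pair.** With the uniform window data of §3 and the
integrated adjacent energies of §4 (`∫_{(t₁,t₂]} (E_{k,k−1} + E_{k,k+1}) ≤ C₃(2+|k|)³`), for every
nearby pair `(j, k)`, `T log T > 0`, and every integrable `φ` on `(t₁, t₂]` dominated there by the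
pointwise majorant `2Kψ_T(j)ψ_T(k)[(2+|j|)²(1 + E_{j,j−1} + E_{j,j+1}) + (2+|k|)²(1 + E_{k,k−1} + E_{k,k+1})]`
(`K = 1/δ + 6C_xS + 16C_x²S`; e.g. the weighted (77) integrand, `abs_weighted_oda_le`):
`∫_{(t₁,t₂]} |φ| ≤ 2K(t₂ − t₁ + C₃) ψ_T(j)ψ_T(k)((2+|j|)⁵ + (2+|k|)⁵)`.
[cite: RodgersTaoFMP2020, Prop. 22 p. 48, proof pp. 49–50 (the display after (79))] -/
theorem setIntegral_abs_le_of_majorant {t₁ t₂ δ Cx S C₃ : ℝ} (h12 : t₁ ≤ t₂)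
    (hδ : 0 < δ) (hCx : 0 ≤ Cx) (hS : 0 ≤ S)
    (hG : ∀ k : ℤ, k ≠ 0 →
      IntegrableOn (fun t ↦ interactionEnergy t k (k - 1) + interactionEnergy t k (k + 1))
          (Ioc t₁ t₂) ∧
        ∫ t in Ioc t₁ t₂, (interactionEnergy t k (k - 1) + interactionEnergy t k (k + 1)) ≤
          C₃ * (2 + |(k : ℝ)|) ^ 3)
    {T : ℝ} (hT : 0 < T * Real.log T) (p : nearbyPairs T) {φ : ℝ → ℝ}
    (hφ : IntegrableOn φ (Ioc t₁ t₂))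
    (hpt : ∀ s ∈ Ioc t₁ t₂, |φ s| ≤
      2 * (1 / δ + 6 * Cx * S + 16 * Cx ^ 2 * S) * (truncWeight T p.1.1 * truncWeight T p.1.2) *
        ((2 + |(p.1.1 : ℝ)|) ^ 2 *
            (1 + (interactionEnergy s p.1.1 (p.1.1 - 1) + interactionEnergy s p.1.1 (p.1.1 + 1))) +
          (2 + |(p.1.2 : ℝ)|) ^ 2 *
            (1 + (interactionEnergy s p.1.2 (p.1.2 - 1) + interactionEnergy s p.1.2 (p.1.2 + 1))))) :
    ∫ s in Ioc t₁ t₂, |φ s| ≤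
      2 * (1 / δ + 6 * Cx * S + 16 * Cx ^ 2 * S) * ((t₂ - t₁) + C₃) *
        (truncWeight T p.1.1 * truncWeight T p.1.2 *
          ((2 + |(p.1.1 : ℝ)|) ^ 5 + (2 + |(p.1.2 : ℝ)|) ^ 5)) := by
  obtain ⟨hj, hk, -⟩ := (nearbyPairs_subset_zstarOffDiag T) p.2
  have hK0 : 0 ≤ 1 / δ + 6 * Cx * S + 16 * Cx ^ 2 * S := by positivity
  have hL0 : 0 ≤ t₂ - t₁ := by linarith
  have hC₃ : 0 ≤ C₃ := by
    obtain ⟨-, h1⟩ := hG 1 one_ne_zero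
    have h0 : 0 ≤ ∫ t in Ioc t₁ t₂, (interactionEnergy t 1 (1 - 1) + interactionEnergy t 1 (1 + 1)) :=
      integral_nonneg fun t ↦ add_nonneg (interactionEnergy_nonneg _ _ _) (interactionEnergy_nonneg _ _ _)
    have h2 : (0 : ℝ) < (2 + |((1 : ℤ) : ℝ)|) ^ 3 := by positivity
    nlinarith
  have hψ0 : ∀ i, 0 ≤ truncWeight T i := fun i ↦ (truncWeight_pos hT i).le
  have hψjk : 0 ≤ truncWeight T p.1.1 * truncWeight T p.1.2 := mul_nonneg (hψ0 _) (hψ0 _)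
  have hwj1 : (1 : ℝ) ≤ 2 + |(p.1.1 : ℝ)| := by have := abs_nonneg (p.1.1 : ℝ); linarith
  have hwk1 : (1 : ℝ) ≤ 2 + |(p.1.2 : ℝ)| := by have := abs_nonneg (p.1.2 : ℝ); linarith
  -- integrability of the majorant
  have hIg := hφ.abs
  obtain ⟨hIj, hIj_le⟩ := hG p.1.1 hj
  obtain ⟨hIk, hIk_le⟩ := hG p.1.2 hk
  have hc1 : IntegrableOn (fun _ : ℝ ↦ (1 : ℝ)) (Ioc t₁ t₂) :=
    integrableOn_const (by exact measure_Ioc_lt_top.ne)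
  have hI1j : IntegrableOn (fun s ↦ 1 + (interactionEnergy s p.1.1 (p.1.1 - 1) +
      interactionEnergy s p.1.1 (p.1.1 + 1))) (Ioc t₁ t₂) := hc1.add hIj
  have hI1k : IntegrableOn (fun s ↦ 1 + (interactionEnergy s p.1.2 (p.1.2 - 1) +
      interactionEnergy s p.1.2 (p.1.2 + 1))) (Ioc t₁ t₂) := hc1.add hIk
  have hImaj : IntegrableOn (fun s ↦
      2 * (1 / δ + 6 * Cx * S + 16 * Cx ^ 2 * S) * (truncWeight T p.1.1 * truncWeight T p.1.2) *
        ((2 + |(p.1.1 : ℝ)|) ^ 2 *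
            (1 + (interactionEnergy s p.1.1 (p.1.1 - 1) + interactionEnergy s p.1.1 (p.1.1 + 1))) +
          (2 + |(p.1.2 : ℝ)|) ^ 2 *
            (1 + (interactionEnergy s p.1.2 (p.1.2 - 1) + interactionEnergy s p.1.2 (p.1.2 + 1)))))
      (Ioc t₁ t₂) := ((hI1j.const_mul _).add (hI1k.const_mul _)).const_mul _
  -- integrate the majorant
  have hint_le := setIntegral_mono_on hIg hImaj measurableSet_Ioc hpt
  have h1j := setIntegral_one_add_le h12 hIj hIj_le
  have h1k := setIntegral_one_add_le h12 hIk hIk_le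
  rw [setIntegral_majorant_eq _ _ _ hI1j hI1k] at hint_le
  have hbj : (2 + |(p.1.1 : ℝ)|) ^ 2 *
        (∫ s in Ioc t₁ t₂, (1 + (interactionEnergy s p.1.1 (p.1.1 - 1) +
          interactionEnergy s p.1.1 (p.1.1 + 1)))) ≤
      ((t₂ - t₁) + C₃) * (2 + |(p.1.1 : ℝ)|) ^ 5 := by
    calc (2 + |(p.1.1 : ℝ)|) ^ 2 * (∫ s in Ioc t₁ t₂, (1 + (interactionEnergy s p.1.1 (p.1.1 - 1) +
          interactionEnergy s p.1.1 (p.1.1 + 1))))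
        ≤ (2 + |(p.1.1 : ℝ)|) ^ 2 * ((t₂ - t₁) + C₃ * (2 + |(p.1.1 : ℝ)|) ^ 3) :=
          mul_le_mul_of_nonneg_left h1j (by positivity)
      _ ≤ ((t₂ - t₁) + C₃) * (2 + |(p.1.1 : ℝ)|) ^ 5 := by
          have e1 : t₂ - t₁ ≤ (t₂ - t₁) * (2 + |(p.1.1 : ℝ)|) ^ 3 :=
            le_mul_of_one_le_right hL0 (one_le_pow₀ hwj1)
          have e2 : (0 : ℝ) ≤ (2 + |(p.1.1 : ℝ)|) ^ 2 := by positivity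
          nlinarith [mul_le_mul_of_nonneg_left e1 e2]
  have hbk : (2 + |(p.1.2 : ℝ)|) ^ 2 *
        (∫ s in Ioc t₁ t₂, (1 + (interactionEnergy s p.1.2 (p.1.2 - 1) +
          interactionEnergy s p.1.2 (p.1.2 + 1)))) ≤
      ((t₂ - t₁) + C₃) * (2 + |(p.1.2 : ℝ)|) ^ 5 := by
    calc (2 + |(p.1.2 : ℝ)|) ^ 2 * (∫ s in Ioc t₁ t₂, (1 + (interactionEnergy s p.1.2 (p.1.2 - 1) +
          interactionEnergy s p.1.2 (p.1.2 + 1))))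
        ≤ (2 + |(p.1.2 : ℝ)|) ^ 2 * ((t₂ - t₁) + C₃ * (2 + |(p.1.2 : ℝ)|) ^ 3) :=
          mul_le_mul_of_nonneg_left h1k (by positivity)
      _ ≤ ((t₂ - t₁) + C₃) * (2 + |(p.1.2 : ℝ)|) ^ 5 := by
          have e1 : t₂ - t₁ ≤ (t₂ - t₁) * (2 + |(p.1.2 : ℝ)|) ^ 3 :=
            le_mul_of_one_le_right hL0 (one_le_pow₀ hwk1)
          have e2 : (0 : ℝ) ≤ (2 + |(p.1.2 : ℝ)|) ^ 2 := by positivity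
          nlinarith [mul_le_mul_of_nonneg_left e1 e2]
  refine hint_le.trans ?_
  have := add_le_add hbj hbk
  calc 2 * (1 / δ + 6 * Cx * S + 16 * Cx ^ 2 * S) * (truncWeight T p.1.1 * truncWeight T p.1.2) *
        ((2 + |(p.1.1 : ℝ)|) ^ 2 *
            (∫ s in Ioc t₁ t₂, (1 + (interactionEnergy s p.1.1 (p.1.1 - 1) +
              interactionEnergy s p.1.1 (p.1.1 + 1)))) +
          (2 + |(p.1.2 : ℝ)|) ^ 2 *
            (∫ s in Ioc t₁ t₂, (1 + (interactionEnergy s p.1.2 (p.1.2 - 1) +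
              interactionEnergy s p.1.2 (p.1.2 + 1)))))
      ≤ 2 * (1 / δ + 6 * Cx * S + 16 * Cx ^ 2 * S) * (truncWeight T p.1.1 * truncWeight T p.1.2) *
          (((t₂ - t₁) + C₃) * (2 + |(p.1.1 : ℝ)|) ^ 5 + ((t₂ - t₁) + C₃) * (2 + |(p.1.2 : ℝ)|) ^ 5) :=
        mul_le_mul_of_nonneg_left this (by positivity)
    _ = _ := by ring

/-- **`hsum` — the dominated-convergence hypothesis of Prop. 22 holds**: on a window `[t₁, t₂]`
above a real-rooted time `t₀ < t₁` where the location law (50) holds, for every `T` with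
`T log T > 0`, `Σ_{j ∼_T k} ψ_T(j)ψ_T(k) ∫_{t₁}^{t₂} |(2Σ'_k − 2Σ'_j)/(x_j − x_k)| dt < ∞` («we can
interchange the outer sum and the integral as soon as we can show that [this] expression is
finite … this will be finite thanks to Proposition 15 and (66)»). Route: `setIntegral_abs_weighted_oda_le`
with the data of §3–§4, and `Σ_j ψ_T(j)(2+|j|)⁵ < ∞` (66).
[cite: RodgersTaoFMP2020, Prop. 22 p. 48, proof pp. 49–50 (display (79) and the two displays after it)] -/
theorem summable_integral_abs_weighted_oda {t₀ t₁ t₂ B : ℝ}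
    (hreal : HasOnlyRealZeros (deBruijnH t₀)) (h01 : t₀ < t₁) (h12 : t₁ < t₂)
    (h50 : ∀ t ∈ Icc t₁ t₂, ∀ n : ℕ, 1 ≤ n →
      |deBruijnZero t n - classicalLocation (n : ℝ)| ≤ B * logPlus (classicalLocation (n : ℝ)))
    {T : ℝ} (hT : 0 < T * Real.log T) :
    Summable fun p : nearbyPairs T ↦ ∫ s in Ioc t₁ t₂,
      |truncWeight T p.1.1 * truncWeight T p.1.2 *
        (-(2 * zeroVelocitySum s p.1.1 - 2 * zeroVelocitySum s p.1.2) /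
          (deBruijnZeroZ s p.1.1 - deBruijnZeroZ s p.1.2))| := by
  obtain ⟨δ, hδ, hfloor⟩ := exists_zero_floor hreal h01 (t₂ := t₂)
  obtain ⟨S', hS'⟩ := exists_invSqSum_le hreal h01 (t₂ := t₂)
  obtain ⟨Cx, hCx, hlin⟩ := exists_abs_zero_le_linear h50
  obtain ⟨C₃, -, hG⟩ := exists_setIntegral_adjEnergy_le hreal h01 h12 h50
  have hS0 : 0 ≤ max S' 0 := le_max_right _ _
  have hSt : ∀ t ∈ Icc t₁ t₂, ∑' m : ℕ, 1 / deBruijnZero t (m + 1) ^ 2 ≤ max S' 0 :=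
    fun t ht ↦ (hS' t ht).trans (le_max_left _ _)
  have hψ0 : ∀ i, 0 ≤ truncWeight T i := fun i ↦ (truncWeight_pos hT i).le
  have hs5 : Summable fun i : ℤ ↦ truncWeight T i * (2 + |(i : ℝ)|) ^ 5 :=
    RodgersTaoTruncEnergyIntegrable.summable_truncWeight_mul_pow hT (by norm_num)
  have hs0 : Summable fun i : ℤ ↦ truncWeight T i :=
    RodgersTaoTruncEnergyIntegrable.summable_truncWeight hT
  -- the majorant is summable over all of `ℤ × ℤ`, hence over the nearby pairs
  have hm : Summable fun q : ℤ × ℤ ↦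
      2 * (1 / δ + 6 * Cx * max S' 0 + 16 * Cx ^ 2 * max S' 0) * ((t₂ - t₁) + C₃) *
        (truncWeight T q.1 * truncWeight T q.2 * ((2 + |(q.1 : ℝ)|) ^ 5 + (2 + |(q.2 : ℝ)|) ^ 5)) := by
    have h1 : Summable fun q : ℤ × ℤ ↦ truncWeight T q.1 * (2 + |(q.1 : ℝ)|) ^ 5 * truncWeight T q.2 :=
      hs5.mul_of_nonneg hs0 (fun i ↦ mul_nonneg (hψ0 i) (by positivity)) hψ0
    have h2 : Summable fun q : ℤ × ℤ ↦ truncWeight T q.1 * (truncWeight T q.2 * (2 + |(q.2 : ℝ)|) ^ 5) :=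
      hs0.mul_of_nonneg hs5 hψ0 (fun i ↦ mul_nonneg (hψ0 i) (by positivity))
    refine ((h1.add h2).mul_left
      (2 * (1 / δ + 6 * Cx * max S' 0 + 16 * Cx ^ 2 * max S' 0) * ((t₂ - t₁) + C₃))).congr
      fun q ↦ ?_
    ring
  refine Summable.of_nonneg_of_le (fun p ↦ integral_nonneg fun s ↦ abs_nonneg _)
    (fun p ↦ setIntegral_abs_le_of_majorant h12.le hδ hCx.le hS0 hG hT p
      (RodgersTaoHamiltonianTermFTC.integrableOn_truncHamiltonianTerm_integrand hreal h01 h12.le p)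
      fun s hs ↦ ?_)
    (hm.subtype _)
  obtain ⟨hj, hk, hne⟩ := (nearbyPairs_subset_zstarOffDiag T) p.2
  have hs' : s ∈ Icc t₁ t₂ := ⟨hs.1.le, hs.2⟩
  exact abs_weighted_oda_le ⟨t₀, by linarith [hs.1], hreal⟩ hδ hCx.le hS0 (hfloor s hs') (hlin s hs')
    (hSt s hs') hT hj hk hne

/-! ## §6 Desymmetrisation: the (77)-series in the printed form (78), and its a.e. absolute convergence -/

/-- The (77)-series desymmetrised, pointwise: if the «half» family
`h_{(j,k)} = ψ_T(j)ψ_T(k)·Σ'_k/(x_k − x_j)` is summable over the nearby pairs at time `s`, then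
`Σ_{j∼_T k} ψψ·(2Σ'_k − 2Σ'_j)/(x_j − x_k) = −4 Σ_{j∼_T k} ψ_T(j)ψ_T(k)·Σ'_k/(x_k − x_j)` — the right-hand
side of (78) («desymmetrize in `j` and `k`»: the swap `(j,k) ↦ (k,j)` is an involution of the nearby
pairs). [cite: RodgersTaoFMP2020, Prop. 22 p. 48 (78)] -/
theorem tsum_weighted_oda_eq_of_summable (T s : ℝ)
    (hS : Summable fun p : nearbyPairs T ↦ truncWeight T p.1.1 * truncWeight T p.1.2 *
      (zeroVelocitySum s p.1.2 / (deBruijnZeroZ s p.1.2 - deBruijnZeroZ s p.1.1))) :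
    ∑' p : nearbyPairs T, truncWeight T p.1.1 * truncWeight T p.1.2 *
        (-(2 * zeroVelocitySum s p.1.1 - 2 * zeroVelocitySum s p.1.2) /
          (deBruijnZeroZ s p.1.1 - deBruijnZeroZ s p.1.2)) =
      -4 * ∑' p : nearbyPairs T, truncWeight T p.1.1 * truncWeight T p.1.2 *
        (zeroVelocitySum s p.1.2 / (deBruijnZeroZ s p.1.2 - deBruijnZeroZ s p.1.1)) := by
  -- the swap involution of the nearby pairs
  set e : nearbyPairs T ≃ nearbyPairs T := (Equiv.prodComm ℤ ℤ).subtypeEquiv (fun q ↦ by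
    simp only [Equiv.prodComm_apply, mem_nearbyPairs, Prod.fst_swap, Prod.snd_swap, nearby_comm]
    tauto) with he
  set h : nearbyPairs T → ℝ := fun p ↦ truncWeight T p.1.1 * truncWeight T p.1.2 *
      (zeroVelocitySum s p.1.2 / (deBruijnZeroZ s p.1.2 - deBruijnZeroZ s p.1.1)) with hh
  have hS' : Summable (h ∘ e) := (e.summable_iff).2 hS
  have hpt : ∀ p : nearbyPairs T, truncWeight T p.1.1 * truncWeight T p.1.2 *
        (-(2 * zeroVelocitySum s p.1.1 - 2 * zeroVelocitySum s p.1.2) /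
          (deBruijnZeroZ s p.1.1 - deBruijnZeroZ s p.1.2)) = -2 * h p + -2 * (h ∘ e) p := by
    intro p
    simp only [hh, he, Function.comp_apply, Equiv.subtypeEquiv_apply, Equiv.prodComm_apply,
      Prod.fst_swap, Prod.snd_swap]
    rw [show deBruijnZeroZ s p.1.2 - deBruijnZeroZ s p.1.1 =
      -(deBruijnZeroZ s p.1.1 - deBruijnZeroZ s p.1.2) by ring, div_neg]
    ring
  have he2 : ∑' p : nearbyPairs T, (h ∘ e) p = ∑' p : nearbyPairs T, h p := e.tsum_eq h
  rw [tsum_congr hpt, (hS.mul_left (-2)).tsum_add (hS'.mul_left (-2)), tsum_mul_left, tsum_mul_left,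
    he2]
  ring

/-- The «half» integrand `ψ_T(j)ψ_T(k)·Σ'_k/(x_k − x_j)` of (78) is dominated by the same pointwise
majorant as the (77)-integrand (per-index bound at `k`; the `j`-part of the majorant is non-negative).
[cite: RodgersTaoFMP2020, Prop. 22 p. 48, proof p. 49 («crudely bound»)] -/
theorem abs_weighted_half_le {t : ℝ} (hΛ : ∃ t₁ : ℝ, t₁ < t ∧ HasOnlyRealZeros (deBruijnH t₁))
    {δ Cx S : ℝ} (hδ : 0 < δ) (hCx : 0 ≤ Cx) (hS : 0 ≤ S)
    (hfloor : ∀ i : ℤ, i ≠ 0 → δ ≤ |deBruijnZeroZ t i|)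
    (hlin : ∀ i : ℤ, |deBruijnZeroZ t i| ≤ Cx * (2 + |(i : ℝ)|))
    (hSt : ∑' m : ℕ, 1 / deBruijnZero t (m + 1) ^ 2 ≤ S)
    {T : ℝ} (hT : 0 < T * Real.log T) {j k : ℤ} (hk : k ≠ 0) (hjk : j ≠ k) :
    |truncWeight T j * truncWeight T k *
        (zeroVelocitySum t k / (deBruijnZeroZ t k - deBruijnZeroZ t j))| ≤
      2 * (1 / δ + 6 * Cx * S + 16 * Cx ^ 2 * S) * (truncWeight T j * truncWeight T k) *
        ((2 + |(j : ℝ)|) ^ 2 * (1 + (interactionEnergy t j (j - 1) + interactionEnergy t j (j + 1))) +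
          (2 + |(k : ℝ)|) ^ 2 *
            (1 + (interactionEnergy t k (k - 1) + interactionEnergy t k (k + 1)))) := by
  set K := 1 / δ + 6 * Cx * S + 16 * Cx ^ 2 * S with hK
  have hK0 : 0 ≤ K := by positivity
  have hψ : 0 ≤ truncWeight T j * truncWeight T k :=
    mul_nonneg (truncWeight_pos hT j).le (truncWeight_pos hT k).le
  have hGj : 0 ≤ interactionEnergy t j (j - 1) + interactionEnergy t j (j + 1) :=
    add_nonneg (interactionEnergy_nonneg _ _ _) (interactionEnergy_nonneg _ _ _)
  have hGk : 0 ≤ interactionEnergy t k (k - 1) + interactionEnergy t k (k + 1) :=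
    add_nonneg (interactionEnergy_nonneg _ _ _) (interactionEnergy_nonneg _ _ _)
  have hwk : (1 : ℝ) ≤ 2 + |(k : ℝ)| := by have := abs_nonneg (k : ℝ); linarith
  set μk := min (deBruijnZeroZ t k - deBruijnZeroZ t (k - 1))
    (deBruijnZeroZ t (k + 1) - deBruijnZeroZ t k) with hμk
  have hμk0 : 0 < μk := min_gap_pos hΛ k
  have hd : μk ≤ |deBruijnZeroZ t k - deBruijnZeroZ t j| := min_gap_le_abs_sub hΛ hjk
  have hVk := abs_zeroVelocitySum_div_gap_le hΛ hk hδ (hfloor k hk) (hlin k) hSt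
  have hPk := poly_absorb hδ hCx hS hwk hGk
  have h1 : |zeroVelocitySum t k / (deBruijnZeroZ t k - deBruijnZeroZ t j)| ≤
      |zeroVelocitySum t k| / μk := by
    rw [abs_div]
    exact div_le_div_of_nonneg_left (abs_nonneg _) hμk0 hd
  rw [abs_mul, abs_of_nonneg hψ]
  calc truncWeight T j * truncWeight T k *
        |zeroVelocitySum t k / (deBruijnZeroZ t k - deBruijnZeroZ t j)|
      ≤ truncWeight T j * truncWeight T k *
          (K * (2 + |(k : ℝ)|) ^ 2 *
            (1 + (interactionEnergy t k (k - 1) + interactionEnergy t k (k + 1)))) :=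
        mul_le_mul_of_nonneg_left (h1.trans (hVk.trans hPk)) hψ
    _ = truncWeight T j * truncWeight T k * K * ((2 + |(k : ℝ)|) ^ 2 *
            (1 + (interactionEnergy t k (k - 1) + interactionEnergy t k (k + 1)))) := by ring
    _ ≤ truncWeight T j * truncWeight T k * K * ((2 + |(k : ℝ)|) ^ 2 *
            (1 + (interactionEnergy t k (k - 1) + interactionEnergy t k (k + 1)))) +
          (truncWeight T j * truncWeight T k * K * ((2 + |(k : ℝ)|) ^ 2 *
              (1 + (interactionEnergy t k (k - 1) + interactionEnergy t k (k + 1)))) +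
            2 * (truncWeight T j * truncWeight T k * K * ((2 + |(j : ℝ)|) ^ 2 *
              (1 + (interactionEnergy t j (j - 1) + interactionEnergy t j (j + 1)))))) := by
        have hA : 0 ≤ truncWeight T j * truncWeight T k * K * ((2 + |(k : ℝ)|) ^ 2 *
            (1 + (interactionEnergy t k (k - 1) + interactionEnergy t k (k + 1)))) :=
          mul_nonneg (mul_nonneg hψ hK0) (by positivity)
        have hB : 0 ≤ truncWeight T j * truncWeight T k * K * ((2 + |(j : ℝ)|) ^ 2 *
            (1 + (interactionEnergy t j (j - 1) + interactionEnergy t j (j + 1)))) :=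
          mul_nonneg (mul_nonneg hψ hK0) (by positivity)
        exact le_add_of_nonneg_right (by linarith)
    _ = _ := by ring

/-- The «half» integrand is continuous in time on a window above a real-rooted time, hence
integrable on `(t₁, t₂]` (Thm. 11: `x_k` and the velocity `2Σ'_k` are continuous; `x_k ≠ x_j`).
[cite: RodgersTaoFMP2020, Thm. 11 p. 27 (56)] -/
theorem integrableOn_weighted_half {t₀ t₁ t₂ : ℝ} (hreal : HasOnlyRealZeros (deBruijnH t₀))
    (h01 : t₀ < t₁) (T : ℝ) (p : nearbyPairs T) :
    IntegrableOn (fun s ↦ truncWeight T p.1.1 * truncWeight T p.1.2 *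
        (zeroVelocitySum s p.1.2 / (deBruijnZeroZ s p.1.2 - deBruijnZeroZ s p.1.1))) (Ioc t₁ t₂) := by
  obtain ⟨-, hk, hne⟩ := (nearbyPairs_subset_zstarOffDiag T) p.2
  have hc : ContinuousOn (fun s ↦ truncWeight T p.1.1 * truncWeight T p.1.2 *
      (zeroVelocitySum s p.1.2 / (deBruijnZeroZ s p.1.2 - deBruijnZeroZ s p.1.1))) (Icc t₁ t₂) := by
    intro s hs
    have hΛ : ∃ t₁' : ℝ, t₁' < s ∧ HasOnlyRealZeros (deBruijnH t₁') := ⟨t₀, by linarith [hs.1], hreal⟩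
    refine ContinuousAt.continuousWithinAt (continuousAt_const.mul ?_)
    exact (RodgersTaoHamiltonianTermFTC.continuousAt_zeroVelocitySum hΛ hk).div
      ((continuousAt_deBruijnZeroZ hΛ _).sub (continuousAt_deBruijnZeroZ hΛ _))
      (deBruijnZeroZ_sub_ne_zero hΛ hne)
  exact hc.integrableOn_Icc.mono_set Ioc_subset_Icc_self

/-- **The «half» series of (78) is absolutely summable at almost every time** of a window above a
real-rooted time where (50) holds (same integrated majorant as `hsum`, then «the integrand is
absolutely integrable in time», `RodgersTaoSeriesAbsContinuity.integrable_tsum_of_summable_integral_abs`).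
[cite: RodgersTaoFMP2020, Prop. 22 p. 48, proof pp. 49–50] -/
theorem ae_summable_weighted_half {t₀ t₁ t₂ B : ℝ}
    (hreal : HasOnlyRealZeros (deBruijnH t₀)) (h01 : t₀ < t₁) (h12 : t₁ < t₂)
    (h50 : ∀ t ∈ Icc t₁ t₂, ∀ n : ℕ, 1 ≤ n →
      |deBruijnZero t n - classicalLocation (n : ℝ)| ≤ B * logPlus (classicalLocation (n : ℝ)))
    {T : ℝ} (hT : 0 < T * Real.log T) :
    ∀ᵐ s ∂(volume.restrict (Ioc t₁ t₂)),
      Summable fun p : nearbyPairs T ↦ truncWeight T p.1.1 * truncWeight T p.1.2 *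
        (zeroVelocitySum s p.1.2 / (deBruijnZeroZ s p.1.2 - deBruijnZeroZ s p.1.1)) := by
  obtain ⟨δ, hδ, hfloor⟩ := exists_zero_floor hreal h01 (t₂ := t₂)
  obtain ⟨S', hS'⟩ := exists_invSqSum_le hreal h01 (t₂ := t₂)
  obtain ⟨Cx, hCx, hlin⟩ := exists_abs_zero_le_linear h50
  obtain ⟨C₃, -, hG⟩ := exists_setIntegral_adjEnergy_le hreal h01 h12 h50
  have hS0 : 0 ≤ max S' 0 := le_max_right _ _
  have hSt : ∀ t ∈ Icc t₁ t₂, ∑' m : ℕ, 1 / deBruijnZero t (m + 1) ^ 2 ≤ max S' 0 :=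
    fun t ht ↦ (hS' t ht).trans (le_max_left _ _)
  have hψ0 : ∀ i, 0 ≤ truncWeight T i := fun i ↦ (truncWeight_pos hT i).le
  have hs5 : Summable fun i : ℤ ↦ truncWeight T i * (2 + |(i : ℝ)|) ^ 5 :=
    RodgersTaoTruncEnergyIntegrable.summable_truncWeight_mul_pow hT (by norm_num)
  have hs0 : Summable fun i : ℤ ↦ truncWeight T i :=
    RodgersTaoTruncEnergyIntegrable.summable_truncWeight hT
  have hm : Summable fun q : ℤ × ℤ ↦
      2 * (1 / δ + 6 * Cx * max S' 0 + 16 * Cx ^ 2 * max S' 0) * ((t₂ - t₁) + C₃) *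
        (truncWeight T q.1 * truncWeight T q.2 * ((2 + |(q.1 : ℝ)|) ^ 5 + (2 + |(q.2 : ℝ)|) ^ 5)) := by
    have h1 : Summable fun q : ℤ × ℤ ↦ truncWeight T q.1 * (2 + |(q.1 : ℝ)|) ^ 5 * truncWeight T q.2 :=
      hs5.mul_of_nonneg hs0 (fun i ↦ mul_nonneg (hψ0 i) (by positivity)) hψ0
    have h2 : Summable fun q : ℤ × ℤ ↦ truncWeight T q.1 * (truncWeight T q.2 * (2 + |(q.2 : ℝ)|) ^ 5) :=
      hs0.mul_of_nonneg hs5 hψ0 (fun i ↦ mul_nonneg (hψ0 i) (by positivity))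
    refine ((h1.add h2).mul_left
      (2 * (1 / δ + 6 * Cx * max S' 0 + 16 * Cx ^ 2 * max S' 0) * ((t₂ - t₁) + C₃))).congr
      fun q ↦ ?_
    ring
  have hInt := fun p ↦ integrableOn_weighted_half hreal h01 T p (t₂ := t₂)
  have hsum : Summable fun p : nearbyPairs T ↦ ∫ s in Ioc t₁ t₂,
      |truncWeight T p.1.1 * truncWeight T p.1.2 *
        (zeroVelocitySum s p.1.2 / (deBruijnZeroZ s p.1.2 - deBruijnZeroZ s p.1.1))| := by
    refine Summable.of_nonneg_of_le (fun p ↦ integral_nonneg fun s ↦ abs_nonneg _)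
      (fun p ↦ setIntegral_abs_le_of_majorant h12.le hδ hCx.le hS0 hG hT p (hInt p) fun s hs ↦ ?_)
      (hm.subtype _)
    obtain ⟨-, hk, hne⟩ := (nearbyPairs_subset_zstarOffDiag T) p.2
    have hs' : s ∈ Icc t₁ t₂ := ⟨hs.1.le, hs.2⟩
    exact abs_weighted_half_le ⟨t₀, by linarith [hs.1], hreal⟩ hδ hCx.le hS0 (hfloor s hs') (hlin s hs')
      (hSt s hs') hT hk hne
  have h := (RodgersTaoSeriesAbsContinuity.integrable_tsum_of_summable_integral_abs
    (μ := volume.restrict (Ioc t₁ t₂)) hInt hsum).1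
  filter_upwards [h] with s hs
  exact (summable_abs_iff).1 hs

/-! ## §7 STAGE A of Proposition 22: absolute continuity and the a.e. derivative of `H̃_T` -/

/-- From «`F'(s) = D(s)` for a.e. `s ∈ (a, b)`» to the `volume.restrict (Icc a b)`-a.e. form with
`deriv` (the endpoints are null). [folklore] -/
private theorem ae_restrict_Icc_of_ae_Ioo {F D : ℝ → ℝ} {a b : ℝ}
    (h : ∀ᵐ s, s ∈ Ioo a b → HasDerivAt F (D s) s) :
    ∀ᵐ s ∂(volume.restrict (Icc a b)), HasDerivAt F (D s) s ∧ deriv F s = D s := by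
  have h1 : ∀ᵐ s ∂(volume.restrict (Ioo a b)), HasDerivAt F (D s) s :=
    (ae_restrict_iff' measurableSet_Ioo).2 h
  rw [Measure.restrict_congr_set Ioo_ae_eq_Icc] at h1
  filter_upwards [h1] with s hs
  exact ⟨hs, hs.deriv⟩

/-- Combining STAGE A's a.e. derivative with the desymmetrisation: a.e. on `[t₁, t₂]`, the half
series of (78) converges absolutely and `∂ₜH̃_T(s) = −4 Σ_{j∼_T k} ψ_T(j)ψ_T(k)·Σ'_k/(x_k − x_j)`, i.e.
(78) holds. [cite: RodgersTaoFMP2020, Prop. 22 p. 48 (78); proof p. 50 («(78) holds at almost every time t»)] -/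
theorem ae_formal_oda {t₁ t₂ T : ℝ}
    (hD : ∀ᵐ s, s ∈ Ioo t₁ t₂ → HasDerivAt (truncHamiltonian T)
      (∑' p : nearbyPairs T,
        truncWeight T p.1.1 * truncWeight T p.1.2 *
          (-(2 * zeroVelocitySum s p.1.1 - 2 * zeroVelocitySum s p.1.2) /
            (deBruijnZeroZ s p.1.1 - deBruijnZeroZ s p.1.2))) s)
    (hH : ∀ᵐ s ∂(volume.restrict (Ioc t₁ t₂)),
      Summable fun p : nearbyPairs T ↦ truncWeight T p.1.1 * truncWeight T p.1.2 *
        (zeroVelocitySum s p.1.2 / (deBruijnZeroZ s p.1.2 - deBruijnZeroZ s p.1.1))) :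
    ∀ᵐ s ∂(volume.restrict (Icc t₁ t₂)),
      Summable (fun p : nearbyPairs T ↦ truncWeight T p.1.1 * truncWeight T p.1.2 *
        (zeroVelocitySum s p.1.2 / (deBruijnZeroZ s p.1.2 - deBruijnZeroZ s p.1.1))) ∧
      HasDerivAt (truncHamiltonian T)
        (-4 * ∑' p : nearbyPairs T, truncWeight T p.1.1 * truncWeight T p.1.2 *
          (zeroVelocitySum s p.1.2 / (deBruijnZeroZ s p.1.2 - deBruijnZeroZ s p.1.1))) s ∧
      deriv (truncHamiltonian T) s =
        -4 * ∑' p : nearbyPairs T, truncWeight T p.1.1 * truncWeight T p.1.2 *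
          (zeroVelocitySum s p.1.2 / (deBruijnZeroZ s p.1.2 - deBruijnZeroZ s p.1.1)) := by
  have h1 := ae_restrict_Icc_of_ae_Ioo hD
  rw [Measure.restrict_congr_set Ioc_ae_eq_Icc] at hH
  filter_upwards [h1, hH] with s hs hsum
  have e := tsum_weighted_oda_eq_of_summable T s hsum
  rw [e] at hs
  exact ⟨hsum, hs.1, hs.2⟩

/-- **Rodgers–Tao 2020, Proposition 22, first sentence + (78) a.e. — RH-FREE CONTENT form
(STAGE A).** On a window `[t₁, t₂]` above a real-rooted time `t₀ < t₁` where the location law (50)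
holds, for every `T` with `T log T > 0` at which the series (69) defining `H̃_T(t₁)` converges
absolutely: the desymmetrised (oda) series
`D_T(s) = Σ_{j ∼_T k} ψ_T(j)ψ_T(k) (2Σ'_k − 2Σ'_j)/(x_j − x_k)` is interval integrable on `[t₁, t₂]`,
`H̃_T(t) = H̃_T(t₁) + ∫_{t₁}^t D_T` on `[t₁, t₂]`, `H̃_T` is absolutely continuous on `[t₁, t₂]`,
and `∂ₜH̃_T(s) = D_T(s)` for almost every `s ∈ (t₁, t₂)` («From the Lebesgue differentiation
theorem, we conclude that `H̃_T` is absolutely continuous and that (78) holds at almost every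
time `t`»). Inputs: the termwise FTC (`RodgersTaoHamiltonianTermFTC`, (77)), `hsum`
(`summable_integral_abs_weighted_oda`, Prop. 15 + (66)), the abstract dominated-convergence /
Lebesgue-differentiation step (`RodgersTaoSeriesAbsContinuity.absolutelyContinuousOnInterval_tsum`).
The identification of `D_T` with `−4Ẽ_T +` negligible (STAGE B, (76)) is not treated here.
[cite: RodgersTaoFMP2020, Prop. 22 p. 48 (= arXiv:1801.05914v4 Prop. 7.7), first sentence and (78); proof pp. 49–50] -/
theorem truncHamiltonian_absolutelyContinuousOnInterval_of {t₀ t₁ t₂ B : ℝ}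
    (hreal : HasOnlyRealZeros (deBruijnH t₀)) (h01 : t₀ < t₁) (h12 : t₁ < t₂)
    (h50 : ∀ t ∈ Icc t₁ t₂, ∀ n : ℕ, 1 ≤ n →
      |deBruijnZero t n - classicalLocation (n : ℝ)| ≤ B * logPlus (classicalLocation (n : ℝ)))
    {T : ℝ} (hT : 0 < T * Real.log T) (hfa : Summable (truncHamiltonianTerm T t₁)) :
    IntervalIntegrable (fun s ↦ ∑' p : nearbyPairs T,
        truncWeight T p.1.1 * truncWeight T p.1.2 *
          (-(2 * zeroVelocitySum s p.1.1 - 2 * zeroVelocitySum s p.1.2) /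
            (deBruijnZeroZ s p.1.1 - deBruijnZeroZ s p.1.2))) volume t₁ t₂ ∧
    (∀ t ∈ Icc t₁ t₂, truncHamiltonian T t = truncHamiltonian T t₁ +
      ∫ s in t₁..t, ∑' p : nearbyPairs T,
        truncWeight T p.1.1 * truncWeight T p.1.2 *
          (-(2 * zeroVelocitySum s p.1.1 - 2 * zeroVelocitySum s p.1.2) /
            (deBruijnZeroZ s p.1.1 - deBruijnZeroZ s p.1.2))) ∧
    AbsolutelyContinuousOnInterval (truncHamiltonian T) t₁ t₂ ∧
    ∀ᵐ s, s ∈ Ioo t₁ t₂ → HasDerivAt (truncHamiltonian T)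
      (∑' p : nearbyPairs T,
        truncWeight T p.1.1 * truncWeight T p.1.2 *
          (-(2 * zeroVelocitySum s p.1.1 - 2 * zeroVelocitySum s p.1.2) /
            (deBruijnZeroZ s p.1.1 - deBruijnZeroZ s p.1.2))) s := by
  have H := RodgersTaoSeriesAbsContinuity.absolutelyContinuousOnInterval_tsum h12.le
    (f := fun (p : nearbyPairs T) t ↦ truncHamiltonianTerm T t p)
    (g := fun (p : nearbyPairs T) s ↦ truncWeight T p.1.1 * truncWeight T p.1.2 *
      (-(2 * zeroVelocitySum s p.1.1 - 2 * zeroVelocitySum s p.1.2) /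
        (deBruijnZeroZ s p.1.1 - deBruijnZeroZ s p.1.2)))
    (fun p ↦ RodgersTaoHamiltonianTermFTC.integrableOn_truncHamiltonianTerm_integrand hreal h01
      h12.le p)
    (summable_integral_abs_weighted_oda hreal h01 h12 h50 hT)
    (fun p t ht ↦ RodgersTaoHamiltonianTermFTC.truncHamiltonianTerm_sub_eq_integral hreal h01 p ht.1)
    hfa
  have e : (fun t ↦ ∑' p : nearbyPairs T, truncHamiltonianTerm T t p) = truncHamiltonian T :=
    funext fun t ↦ (truncHamiltonian_eq T t).symm
  rw [e] at H
  obtain ⟨H1, H2, H3, H4⟩ := H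
  refine ⟨H1, fun t ht ↦ ?_, H3, H4⟩
  have := H2 t ht
  rw [truncHamiltonian_eq T t, truncHamiltonian_eq T t₁]
  exact this

/-- **STAGE A of Prop. 22 with the L¹ input from Lemma 19** (content form): on a window `[t₁, t₂]`
above a real-rooted time where (50) holds there is `T₁` such that for all `T ≥ T₁`, `H̃_T` is
absolutely continuous on `[t₁, t₂]` with a.e. derivative the (77)-series `D_T` (the absolute
convergence of (69) at `t₁` being Lemma 19's content twin
`rodgers_tao_truncHamiltonian_expansion_of`), and (78) holds for a.e. `t ∈ [t₁, t₂]`: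
`∂ₜH̃_T(t) = −4 Σ_{j∼_T k} ψ_T(j)ψ_T(k)·Σ'_k/(x_k − x_j)` with the series absolutely convergent.
[cite: RodgersTaoFMP2020, Prop. 22 p. 48, first sentence and (78); proof pp. 49–50; Lemma 19 p. 44] -/
theorem truncHamiltonian_absolutelyContinuousOnInterval_eventually {t₀ t₁ t₂ B : ℝ}
    (hreal : HasOnlyRealZeros (deBruijnH t₀)) (h01 : t₀ < t₁) (h12 : t₁ < t₂)
    (h50 : ∀ t ∈ Icc t₁ t₂, ∀ n : ℕ, 1 ≤ n →
      |deBruijnZero t n - classicalLocation (n : ℝ)| ≤ B * logPlus (classicalLocation (n : ℝ))) :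
    ∃ T₁ : ℝ, ∀ T : ℝ, T₁ ≤ T →
      AbsolutelyContinuousOnInterval (truncHamiltonian T) t₁ t₂ ∧
      (∀ t ∈ Icc t₁ t₂, truncHamiltonian T t = truncHamiltonian T t₁ +
        ∫ s in t₁..t, ∑' p : nearbyPairs T,
          truncWeight T p.1.1 * truncWeight T p.1.2 *
            (-(2 * zeroVelocitySum s p.1.1 - 2 * zeroVelocitySum s p.1.2) /
              (deBruijnZeroZ s p.1.1 - deBruijnZeroZ s p.1.2))) ∧
      (∀ᵐ s, s ∈ Ioo t₁ t₂ → HasDerivAt (truncHamiltonian T)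
        (∑' p : nearbyPairs T,
          truncWeight T p.1.1 * truncWeight T p.1.2 *
            (-(2 * zeroVelocitySum s p.1.1 - 2 * zeroVelocitySum s p.1.2) /
              (deBruijnZeroZ s p.1.1 - deBruijnZeroZ s p.1.2))) s) ∧
      ∀ᵐ s ∂(volume.restrict (Icc t₁ t₂)),
        Summable (fun p : nearbyPairs T ↦ truncWeight T p.1.1 * truncWeight T p.1.2 *
          (zeroVelocitySum s p.1.2 / (deBruijnZeroZ s p.1.2 - deBruijnZeroZ s p.1.1))) ∧
        HasDerivAt (truncHamiltonian T)
          (-4 * ∑' p : nearbyPairs T, truncWeight T p.1.1 * truncWeight T p.1.2 *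
            (zeroVelocitySum s p.1.2 / (deBruijnZeroZ s p.1.2 - deBruijnZeroZ s p.1.1))) s ∧
        deriv (truncHamiltonian T) s =
          -4 * ∑' p : nearbyPairs T, truncWeight T p.1.1 * truncWeight T p.1.2 *
            (zeroVelocitySum s p.1.2 / (deBruijnZeroZ s p.1.2 - deBruijnZeroZ s p.1.1)) := by
  obtain ⟨T₁, hT₁⟩ := rodgers_tao_truncHamiltonian_expansion_of h01 hreal h50 1 one_pos
  refine ⟨max T₁ 2, fun T hT ↦ ?_⟩
  have hT1 : T₁ ≤ T := (le_max_left _ _).trans hT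
  have hT2 : (2 : ℝ) ≤ T := (le_max_right _ _).trans hT
  have hTlog : 0 < T * Real.log T := mul_pos (by linarith) (Real.log_pos (by linarith))
  have hfa : Summable (truncHamiltonianTerm T t₁) := (hT₁ T hT1 t₁ ⟨le_rfl, h12.le⟩).1
  obtain ⟨-, H2, H3, H4⟩ :=
    truncHamiltonian_absolutelyContinuousOnInterval_of hreal h01 h12 h50 hTlog hfa
  exact ⟨H3, H2, H4, ae_formal_oda H4 (ae_summable_weighted_half hreal h01 h12 h50 hTlog)⟩


end RodgersTaoTruncHamiltonianAC

/-- **Rodgers–Tao 2020, Proposition 22 — STAGE A in the AS-PRINTED range** `[Λ/2, 0]` read in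
the witness form of the typed fact `rodgers_tao_truncHamiltonian_deriv` (window `[t₀/2, 0]` above a
witness `t₀ < 0` with `H_{t₀}` real-rooted), from the AS-PRINTED location law (50)
`RodgersTao2020.cor33_location` (itself a content theorem, `RodgersTao2020.cor33_location_content`):
there is `T₁` with, for all `T ≥ T₁`, `AbsolutelyContinuousOnInterval (truncHamiltonian T) (t₀/2) 0`,
`∂ₜH̃_T = D_T` a.e. on `(t₀/2, 0)` (the (77)-series) and (78) for a.e. `t ∈ [t₀/2, 0]`:
`∂ₜH̃_T(t) = −4 Σ_{j∼_T k} ψ_T(j)ψ_T(k)·Σ'_k/(x_k − x_j)`, the series absolutely convergent. The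
remaining content of Prop. 22 — the identification of this with `−4Ẽ_T + o(T log³ T + Ẽ_T)` (76) —
is STAGE B, not treated here.
[cite: RodgersTaoFMP2020, Prop. 22 p. 48 (= arXiv:1801.05914v4 Prop. 7.7), first sentence and (78); proof pp. 49–50; Cor. 10 (50) p. 23] -/
theorem RodgersTao2020.truncHamiltonian_absolutelyContinuousOnInterval_of_cor33_location
    (h : RodgersTao2020.cor33_location) {t₀ : ℝ} (ht₀ : t₀ < 0)
    (hreal : HasOnlyRealZeros (deBruijnH t₀)) :
    ∃ T₁ : ℝ, ∀ T : ℝ, T₁ ≤ T →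
      AbsolutelyContinuousOnInterval (truncHamiltonian T) (t₀ / 2) 0 ∧
      (∀ t ∈ Icc (t₀ / 2) 0, truncHamiltonian T t = truncHamiltonian T (t₀ / 2) +
        ∫ s in (t₀ / 2)..t, ∑' p : nearbyPairs T,
          truncWeight T p.1.1 * truncWeight T p.1.2 *
            (-(2 * zeroVelocitySum s p.1.1 - 2 * zeroVelocitySum s p.1.2) /
              (deBruijnZeroZ s p.1.1 - deBruijnZeroZ s p.1.2))) ∧
      (∀ᵐ s, s ∈ Ioo (t₀ / 2) 0 → HasDerivAt (truncHamiltonian T)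
        (∑' p : nearbyPairs T,
          truncWeight T p.1.1 * truncWeight T p.1.2 *
            (-(2 * zeroVelocitySum s p.1.1 - 2 * zeroVelocitySum s p.1.2) /
              (deBruijnZeroZ s p.1.1 - deBruijnZeroZ s p.1.2))) s) ∧
      ∀ᵐ s ∂(volume.restrict (Icc (t₀ / 2) 0)),
        Summable (fun p : nearbyPairs T ↦ truncWeight T p.1.1 * truncWeight T p.1.2 *
          (zeroVelocitySum s p.1.2 / (deBruijnZeroZ s p.1.2 - deBruijnZeroZ s p.1.1))) ∧
        HasDerivAt (truncHamiltonian T)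
          (-4 * ∑' p : nearbyPairs T, truncWeight T p.1.1 * truncWeight T p.1.2 *
            (zeroVelocitySum s p.1.2 / (deBruijnZeroZ s p.1.2 - deBruijnZeroZ s p.1.1))) s ∧
        deriv (truncHamiltonian T) s =
          -4 * ∑' p : nearbyPairs T, truncWeight T p.1.1 * truncWeight T p.1.2 *
            (zeroVelocitySum s p.1.2 / (deBruijnZeroZ s p.1.2 - deBruijnZeroZ s p.1.1)) := by
  obtain ⟨A50, hA50⟩ := h
  exact RodgersTaoTruncHamiltonianAC.truncHamiltonian_absolutelyContinuousOnInterval_eventually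
    (t₁ := t₀ / 2) (t₂ := 0) (B := A50) hreal (by linarith) (by linarith)
    (fun t ht n hn ↦ hA50 t ⟨t₀, by linarith [ht.1], hreal⟩ ht.2 n hn)


end Literature.NumberTheory.LFunctions

end
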